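import Summits.ABC.ABC.Theses.RibetTakahashiSplit
import Literature.NumberTheory.EllipticCurves.SzpiroFreyCurveProofs
import Literature.NumberTheory.DiophantineGeometry.ValuationProductElliptic
import Literature.NumberTheory.Sieve.ChenTheoremIHolds

/-!
# Disproof of `FewPrimeValuationProduct` — findings (cdisprove seats g1 + g2, stmt-ABC-1563)

Crux (route ABC/RibetTakahashiSplit, r4): for every `ε > 0` there is `C` with
`T(E) := ∏_{p ∥ N_E} v_p(Δ_min(E)) ≤ C · N_E^ε` for every elliptic `E/ℚ` semistable away from `2`
(H_sf: `p² ∤ N` for odd `p`) with at most `3` odd multiplicative primes (H_card). `T` is by `rfl` the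
Literature quantity `multiplicativeValuationProduct` (`ValuationProductElliptic.lean`).

WARNING (audit): `fewPrimeValuationProduct_of_szpiro` / `manyPrimeValuationProduct_of_szpiro`
below are CONDITIONAL on the hypothesis `hS : SzpiroConjecture` (an OPEN `@[conjecture]`); the
file-audit nevertheless classifies them `proof-of-item, closed = true` because a registered
conjecture counts as a registered hypothesis. They must NEVER be filed under `Theorems/` against
the items — they settle nothing; they live here as evidence only (Literature form:
`ValuationProductOfSzpiroProofs`, conclusions not phrased as the route decls).

VERDICT OF THIS FILE: the crux RESISTS — `fewPrimeValuationProduct_of_szpiro : SzpiroConjecture →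
FewPrimeValuationProduct` (§3) is a theorem, so any refutation refutes Szpiro's conjecture on the
few-prime class; no junk escape exists (N ≥ 1, `T ≥ 1`, genuine `ord_p` via the discharged
`factorization_*_holds`). What is false, and proved false here, are the natural strengthenings.

## Index (everything `lean check` rc 0, no `sorry`, axioms ⊆ {propext, Classical.choice, Quot.sound})

§0 `FewPrimeBound ε` — the crux at a fixed exponent; `fewPrimeValuationProduct_iff` (`Iff.rfl`).
§1 The Mersenne–Frey family `mersenneFrey n : y² = x(x+1)(x+2ⁿ)` (= `freyCurve (-1) (2^n)`, Serre
   normalisation, `n ≥ 5`), computed EXACTLY from the discharged Frey facts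
   (`conductorNorm_freyCurve_of_mod_holds`, `minimalDiscriminantNorm_freyCurve_of_mod_holds`):
   * `conductorNorm_mersenneFrey_eq`      `N = 2 · rad(2ⁿ - 1)`,  `conductorNorm_mersenneFrey_lt` `N < 2ⁿ⁺¹`;
   * `minimalDiscriminantNorm_mersenneFrey` `Δ_min = 2^(2n-8) · (2ⁿ - 1)²`;
   * `multiplicativeValuationProduct_mersenneFrey` `T = (2n - 8) · ∏_{p ∣ 2ⁿ-1} 2 v_p(2ⁿ - 1) ≥ 2n - 8`
     (`le_multiplicativeValuationProduct_mersenneFrey`), i.e. `T > 2 log₂ N - 10` along the family;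
   * `oddMultiplicativePrimes_mersenneFrey`: the crux's odd-multiplicative set is `primeFactors (2ⁿ - 1)`,
     so the curve is in the FEW-prime class iff `ω(2ⁿ - 1) ≤ 3`, in the MANY-prime class iff `≥ 4`.
§2 Load-bearing analysis of H_ε (`0 < ε`):
   * `not_fewPrimeBound_zero` — **UNCONDITIONAL: ε CANNOT be dropped from the crux.** Chen's theorem
     in Goldbach form is PROVED in the tree (`Literature.NumberTheory.Sieve.chen_goldbach_holds`,
     standard axioms): `2ⁿ = ℓ + m`, `ℓ` prime, `Ω(m) ≤ 2`; the Frey curve `freyCurve a (2ⁿ)` with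
     `a = -ℓ` or `-m` (whichever is `≡ 1 (4)`; Mersenne–Frey of `n-1` if `ℓ = 2`) is in the few-prime
     class with `T ≥ 2n - 10` (`freyCurve_two_pow_spec`: `≤ ω|a| + ω|a+2ⁿ|` odd multiplicative
     primes, `T ≥ 2n - 8`). Landed as Literature `PastenValuationProductEpsilonChenProofs` (p69251).
   * `not_fewPrimeBound_zero_of_frequently_omega_le_three` — the earlier conditional form
     (`ω(2ⁿ - 1) ≤ 3` unboundedly often), kept for the record.
   * `not_manyPrimeBound_zero` — UNCONDITIONAL: ε cannot be dropped from the sibling crux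
     `ManyPrimeValuationProduct` (stmt-ABC-1561): `n = 12k`, `3·5·7·13 ∣ 2ⁿ - 1`, `T ≥ 24k - 8`.
   * `not_valuationProductBound_zero` — UNCONDITIONAL: with H_card dropped (union of the two cruxes =
     Pasten's Conj. 1.14 shape for curves semistable away from 2) ε cannot be dropped.
   * `fewPrime_witness_13` (`N = 16382`, `T = 36`), `fewPrime_witness_127` (`N = 2·M₁₂₇`, `T = 492`,
     Lucas–Lehmer in the kernel): explicit members of the few-prime class (ONE odd multiplicative
     prime); hence `fewPrimeBound_zero_const_ge` (every uniform constant is `≥ 492`) and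
     `not_fewPrime_le_five` (Mestre–Oesterlé's prime-conductor constant `5` does not extend).
   * general Serre-normalised Frey curves (`conductorNorm_freyCurve_serre`,
     `multiplicativeValuationProduct_freyCurve_serre`: `N = rad m`, `T = ∏_{p∣m} (2v_p(m) - 8[p=2])`,
     `m = |ab(a+b)|`) and the witness `13 + 3⁵ = 2⁸` (`fewPrime_witness_13_243_256`: `N = 78`,
     `T = 8·10·2 = 160 > N`), whence `not_fewPrime_le_conductor`: even "`T(E) ≤ N_E`" (`C = 1`,
     `ε = 1`) is false on the few-prime class. (Other small members: `3 + 5³ = 2⁷`: `N = 30`, `T = 72`;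
     `2 + 3¹⁰·109 = 23⁵` (additive at 2): `T = 400`.)
§3 Why it resists: `fewPrimeBoundWithoutSemistable_of_szpiro` — Szpiro ⟹ the crux WITH H_sf DROPPED
   (additive odd primes allowed): `v_p(Δ_min) log 2 ≤ log C + 7 log N ≤ log C + (28/ε) N^{ε/4}` and the
   product has `≤ 4` factors; `fewPrimeValuationProduct_of_szpiro`. Consequences for provers:
   (i) H_sf is NOT load-bearing (it is there because the Assembly only feeds Frey curves);
   (ii) H_card is not load-bearing either: `valuationProduct_le_of_szpiro` — Szpiro ⟹
   `T ≤ K_ε N^ε` for EVERY elliptic curve (no prime count, no semistability; de Weger/Hindry-type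
   bookkeeping `x ≤ p^{δx}/(δ log p)`), whence `manyPrimeValuationProduct_of_szpiro` (sibling r2)
   and `valuationProductBound_of_szpiro` (union): the whole valuation-product line is sandwiched
   under Szpiro, and refuting ANY of r2 / r4 / union refutes Szpiro;
   (iii) the exponent is far from tight: `fewPrime_polylog_of_szpiro` — under Szpiro,
   `T ≤ (A + (7/log 2) log N)^4` on the class (heuristic truth `(log N)³` by Lagrange on
   `∑ x_p log p ≤ 7 log N` over ≤ 4 primes), while the Chen family gives `T > log₂ N - 9`
   infinitely often IN the few-prime class, unconditionally (`N ≤ 2ℓ·rad m < 2^{2n-1}`), and the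
   Mersenne–Frey family `T > 2 log₂ N - 10` whenever `ω(2ⁿ - 1) ≤ 3`.
§4 Near-misses / not formalised (prose only): `T ≤ C (log N)^k` strengthenings (k ≤ 2 heuristically
   false via `2^x 3^y + 5^z = prime`, unprovable either way); Szpiro-free proofs of any case beyond
   `ω(N) = 1` semistable (Mestre–Oesterlé, named fact `mestreOesterle1989_thm_1`, modularity-deep).
   POINTER FOR PROVERS (search-degraded this session — searchd down — so unverified on the page):
   a POLYNOMIAL bound `T ≤ C N^A` on the WHOLE few-prime class (including the sub-case "one odd
   multiplicative prime, `4 ∣ N`" that the grounders found uncovered by Pasten Cor. 16.2) should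
   follow from the von Känel–Matschke height–conductor inequality `h_F(E) ≪ N log N` (modularity +
   isogeny estimates; item source VonkanelMatschke2023, not in the tree): `v_p(Δ_min) log p ≤
   log|Δ_min| ≤ 12 h_F(E) + O(1)`, four factors. The crux's content is thus the exponent reduction
   poly(N) → N^ε, exactly the Stewart–Yu → sub-exponential gap of `BakerMethodBounds`.

§5 CYCLE 2 (g2, 2026-08-16; all rc 0, no `sorry`): `exists_chen_member` (the Chen family packaged:
   for every large `n` a member of the class with `2 ∥ N`, `v₂(Δ_min) ≥ 2n-10`, `T ≥ 2n-10`,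
   `N < 2^{3n}`) and, from it: (a) `fewPrimeValuationProduct_false_uniform_constant` — the QUANTIFIER
   SWAP `∃ C ∀ ε > 0` is FALSE (no constant serves all `ε`; `C(ε) → ∞` in any proof);
   `fewPrimeBoundWith_const_ge` — `C(ε) ≥ 1/(8ε)` for all small `ε`, unconditionally (vs `≤ (c/ε)^4`
   under Szpiro, §3: the true order of `C(ε)` is OPEN between `1/ε` and `1/ε^4`); (b)
   `fewPrime_unbounded_and_log_le` — tightness: `T ≥ (log N)/3` with `T → ∞` (linear in `log N` is
   the unconditional floor; `(log N)^{1+δ}` floors would need two large exponents on ≤ 3 odd primes,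
   i.e. `ω(3^k - 2^k) ≤ 2`-type inputs, open); (c) `not_fewPrime_valuation_le_of_prime` — NO bound
   `v_p(Δ_min) ≤ f(p)` in the multiplicative prime alone (Mestre–Oesterlé's `≤ 5` is special to
   `N = p`; witness `p = 2`); (c') TRIPLE-language tightness of the stubs of crux-idea
   `matveev-face-clearing` (`SketchIdeator1.lean`), from `exists_chen_triple` (Chen only, no curves):
   `not_facePolylogWith_of_lt_one` / `one_le_of_facePolylogWith` — `PowerOfTwoFacePolylog` is FALSE
   for every `A < 1` (the dividend needs `A ≥ 1`; the card's `A = 4` is consistent, `A = 1` is the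
   conjectural truth), `freyFewPrime_false_without_eps` — `FreyFewPrimeValuationProduct` needs its
   `ε`; (e) `not_hardCoreBoundWith_zero_of_pattern` — the `ε`-drop of `HardCoreBound` is false MODULO
   the binary prime pattern `3^x + 2r = q` i.o. (`ThreePowPlusTwicePrimePattern`, Sophie-Germain type,
   open): the exact input an HC refutation needs — Chen controls one summand only, so every
   unconditional family here lives on the power-of-two face. NOT load-bearing, for the record:
   `[W.IsElliptic]` (a singular `W` has the junk values `N = 1`, `Δ_min = 1`, so `T = 1`).
   Cycle-2 files for the tree (negative support, `--supports stmt-ABC-1563`):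
   `Theorems/FewPrimeValuationProduct/Negative/ChenFamily.lean`, `…/Negative/FaceTightness.lean`.

LANDED (Literature, all accepted): p68371 `PastenValuationProductEpsilonProofs` (family, conditional
ε-drop, sibling/union ε-drop, witnesses 13/127), p68443 + p68860 `ValuationProductOfSzpiroProofs`
(Szpiro ⟹ crux-shape without H_sf, general `k`; and for ALL curves, no hypotheses), p68471
`SerreFreyValuationProductProofs` (closed form of `T` for Serre–Frey curves; witnesses `13+243=256`,
`3+125=128`; "`T ≤ N`" false), p69251 `PastenValuationProductEpsilonChenProofs` (UNCONDITIONAL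
few-prime ε-drop via `chen_goldbach_holds`). The gate refuses `Theorems/<Crux>/Negative/*` from
refuters (only `¬ Theses-decl`), hence Literature.

Barriers consulted: `Literature.Barriers.ABC.SzpiroEpsilonCannotBeDropped*` (Masser: many primes —
complementary to this file's few-prime families), `EpsilonCannotBeDropped`, `BakerMethodBounds`
(benchmark only). Negatives index: no prior refutation touches r4.
-/

noncomputable section

set_option linter.dupNamespace false

namespace Summit.ABC.ABC.Cruxes.FewPrimeValuationProduct.Disproof

open Literature.NumberTheory.EllipticCurves Literature.NumberTheory.DiophantineGeometry
open UniqueFactorizationMonoid WeierstrassCurve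
open Summit.ABC.ABC.Theses.RibetTakahashiSplit

/-! ## §0 The crux at a fixed exponent -/

/-- The crux `FewPrimeValuationProduct` at a FIXED real exponent `ε` (so that the crux is
`∀ ε > 0, FewPrimeBound ε`, `fewPrimeValuationProduct_iff`, and "the crux with `ε` dropped" is
`FewPrimeBound 0`). `multiplicativeValuationProduct W` is by `rfl` the route's inline product
`∏_{p ∣ N, p² ∤ N} v_p(Δ_min)`. -/
def FewPrimeBound (ε : ℝ) : Prop :=
  ∃ C : ℝ, ∀ (W : WeierstrassCurve ℚ) [W.IsElliptic],
    (∀ p : ℕ, p.Prime → p ≠ 2 → ¬ p ^ 2 ∣ W.conductorNorm ℤ) →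
    ((W.conductorNorm ℤ).primeFactors.filter
        (fun p => p ≠ 2 ∧ ¬ p ^ 2 ∣ W.conductorNorm ℤ)).card ≤ 3 →
    (multiplicativeValuationProduct W : ℝ) ≤ C * (W.conductorNorm ℤ : ℝ) ^ ε

theorem fewPrimeValuationProduct_iff :
    FewPrimeValuationProduct ↔ ∀ ε : ℝ, 0 < ε → FewPrimeBound ε := Iff.rfl

/-! ## §1 The Mersenne–Frey family `y² = x (x + 1) (x + 2ⁿ)` -/

/-- The Frey curve of the relation `(-1) + 2ⁿ = 2ⁿ - 1` (Serre's normalisation `a = -1 ≡ -1 (4)`,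
`32 ∣ b = 2ⁿ` for `n ≥ 5`): `y² = x (x + 1) (x + 2ⁿ)`. -/
def mersenneFrey (n : ℕ) : WeierstrassCurve ℚ := freyCurve (-1) (2 ^ n)

section Family

variable {n : ℕ}

/-- `-1` and `2ⁿ` are coprime. [folklore] -/
private theorem hcop (n : ℕ) : IsCoprime (-1 : ℤ) (2 ^ n) := isCoprime_one_left.neg_left

/-- `-1 ≡ -1 (mod 4)` (Serre's normalisation of `a`). [folklore] -/
private theorem hmod : (-1 : ℤ) ≡ -1 [ZMOD 4] := Int.ModEq.refl _

/-- `32 ∣ 2ⁿ` for `n ≥ 5` (Serre's normalisation of `b`). [folklore] -/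
private theorem h32 (hn : 5 ≤ n) : (32 : ℤ) ∣ 2 ^ n := by
  rw [show (32 : ℤ) = 2 ^ 5 by norm_num]; exact pow_dvd_pow 2 hn

/-- `(2ⁿ - 1 : ℕ)` cast to `ℤ`. [folklore] -/
private theorem mersenne_cast (n : ℕ) : ((mersenne n : ℕ) : ℤ) = 2 ^ n - 1 := by
  have h := congrArg (fun k : ℕ => (k : ℤ)) (succ_mersenne n)
  push_cast at h
  linear_combination h

/-- `ab(a+b) = -(2ⁿ (2ⁿ - 1))` for `(a, b) = (-1, 2ⁿ)`. [folklore] -/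
private theorem prod_eq (n : ℕ) :
    (-1 : ℤ) * 2 ^ n * (-1 + 2 ^ n) = -((2 ^ n * mersenne n : ℕ) : ℤ) := by
  push_cast [mersenne_cast]; ring

/-- `2ⁿ - 1 ≠ 0` for `n ≥ 1`. [folklore] -/
private theorem mersenne_ne_zero (hn : 1 ≤ n) : mersenne n ≠ 0 :=
  (mersenne_pos.mpr hn).ne'

/-- `ab(a+b) ≠ 0` for `(a, b) = (-1, 2ⁿ)`, `n ≥ 1`. [folklore] -/
private theorem hne (hn : 1 ≤ n) : (-1 : ℤ) * 2 ^ n * (-1 + 2 ^ n) ≠ 0 := by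
  rw [prod_eq, neg_ne_zero, Int.natCast_ne_zero]
  exact mul_ne_zero (pow_ne_zero _ two_ne_zero) (mersenne_ne_zero hn)

theorem isElliptic_mersenneFrey (hn : 1 ≤ n) : (mersenneFrey n).IsElliptic :=
  isElliptic_freyCurve (hne hn)

/-- `N(mersenneFrey n) = rad (2ⁿ (2ⁿ - 1))` for `n ≥ 5` (discharged fact
`conductorNorm_freyCurve_of_mod_holds`, Serre/Diamond–Kramer/B–G Ex. 12.5.10). -/
theorem conductorNorm_mersenneFrey (hn : 5 ≤ n) :
    (mersenneFrey n).conductorNorm ℤ = radical (2 ^ n * mersenne n) := by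
  have h := conductorNorm_freyCurve_of_mod_holds (-1) (2 ^ n) (hcop n) (hne (by omega)) hmod (h32 hn)
  rw [mersenneFrey, h, prod_eq, UniqueFactorizationDomain.radical_neg, ← Int.radical_natAbs_eq_radical]
  simp only [Int.natAbs_natCast]

/-- `Δ_min(mersenneFrey n) = 2^(2n-8) (2ⁿ - 1)²` for `n ≥ 5` (discharged fact
`minimalDiscriminantNorm_freyCurve_of_mod_holds`). -/
theorem minimalDiscriminantNorm_mersenneFrey (hn : 5 ≤ n) :
    (mersenneFrey n).minimalDiscriminantNorm ℤ = 2 ^ (2 * n - 8) * mersenne n ^ 2 := by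
  have h := minimalDiscriminantNorm_freyCurve_of_mod_holds (-1) (2 ^ n) (hcop n) (hne (by omega))
    hmod (h32 hn)
  rw [prod_eq, neg_sq, ← Nat.cast_pow, Int.natAbs_natCast, mul_pow, ← pow_mul,
    show n * 2 = 8 + (2 * n - 8) by omega, pow_add, mul_assoc] at h
  exact Nat.eq_of_mul_eq_mul_left (by positivity) h

/-! ### Arithmetic of the family: conductor, bad primes, valuations -/

/-- `2ⁿ - 1` is odd. [folklore] -/
private theorem two_notMem_primeFactors_mersenne (hn : 1 ≤ n) : 2 ∉ (mersenne n).primeFactors :=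
  fun h => (mersenne_odd.mpr (by omega)).not_two_dvd_nat (Nat.dvd_of_mem_primeFactors h)

/-- Prime factors of `2ⁿ (2ⁿ - 1)`. [folklore] -/
private theorem primeFactors_two_pow_mul_mersenne (hn : 1 ≤ n) :
    (2 ^ n * mersenne n).primeFactors = insert 2 (mersenne n).primeFactors := by
  rw [Nat.primeFactors_mul (pow_ne_zero _ two_ne_zero) (mersenne_ne_zero hn),
    Nat.primeFactors_pow _ (by omega : n ≠ 0), Nat.prime_two.primeFactors, Finset.insert_eq]

/-- The bad primes of `mersenneFrey n` are `2` and the primes of `2ⁿ - 1`. -/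
theorem primeFactors_conductorNorm_mersenneFrey (hn : 5 ≤ n) :
    ((mersenneFrey n).conductorNorm ℤ).primeFactors = insert 2 (mersenne n).primeFactors := by
  rw [conductorNorm_mersenneFrey hn, Nat.primeFactors_radical,
    primeFactors_two_pow_mul_mersenne (by omega)]

/-- `mersenneFrey n` is semistable: its conductor is squarefree. -/
theorem squarefree_conductorNorm_mersenneFrey (hn : 5 ≤ n) :
    Squarefree ((mersenneFrey n).conductorNorm ℤ) := by
  rw [conductorNorm_mersenneFrey hn]; exact squarefree_radical

/-- `N(mersenneFrey n) = 2 · rad (2ⁿ - 1)`. -/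
theorem conductorNorm_mersenneFrey_eq (hn : 5 ≤ n) :
    (mersenneFrey n).conductorNorm ℤ = 2 * radical (mersenne n) := by
  rw [conductorNorm_mersenneFrey hn, Nat.radical_eq_prod_primeFactors,
    primeFactors_two_pow_mul_mersenne (by omega),
    Finset.prod_insert (two_notMem_primeFactors_mersenne (by omega)), Nat.radical_eq_prod_primeFactors]

/-- `N(mersenneFrey n) < 2ⁿ⁺¹` (so `n > log₂ N - 1`). -/
theorem conductorNorm_mersenneFrey_lt (hn : 5 ≤ n) :
    (mersenneFrey n).conductorNorm ℤ < 2 ^ (n + 1) := by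
  rw [conductorNorm_mersenneFrey_eq hn, pow_succ']
  have h1 : radical (mersenne n) ≤ mersenne n :=
    Nat.radical_le_self_iff.mpr (mersenne_ne_zero (by omega))
  have h2 : mersenne n < 2 ^ n := by rw [← succ_mersenne]; exact Nat.lt_succ_self _
  calc 2 * radical (mersenne n) ≤ 2 * mersenne n := Nat.mul_le_mul_left 2 h1
    _ < 2 * 2 ^ n := Nat.mul_lt_mul_of_pos_left h2 two_pos

/-- `v₂(Δ_min) = 2n - 8`: the large valuation sits at the multiplicative prime `2`. -/
theorem factorization_two_minimalDiscriminantNorm_mersenneFrey (hn : 5 ≤ n) :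
    ((mersenneFrey n).minimalDiscriminantNorm ℤ).factorization 2 = 2 * n - 8 := by
  have h2 : ¬ 2 ∣ mersenne n := (mersenne_odd.mpr (by omega)).not_two_dvd_nat
  rw [minimalDiscriminantNorm_mersenneFrey hn,
    Nat.factorization_mul (pow_ne_zero _ two_ne_zero) (pow_ne_zero _ (mersenne_ne_zero (by omega)))]
  simp [Nat.factorization_pow, Nat.prime_two.factorization_self, Nat.factorization_eq_zero_of_not_dvd h2]

/-- `v_p(Δ_min) = 2 v_p(2ⁿ - 1)` at an odd bad prime `p`. -/
theorem factorization_odd_minimalDiscriminantNorm_mersenneFrey (hn : 5 ≤ n) {p : ℕ}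
    (hp : p ∈ (mersenne n).primeFactors) :
    ((mersenneFrey n).minimalDiscriminantNorm ℤ).factorization p =
      2 * (mersenne n).factorization p := by
  have hp2 : (2 : ℕ) ≠ p := fun h => two_notMem_primeFactors_mersenne (n := n) (by omega) (h ▸ hp)
  rw [minimalDiscriminantNorm_mersenneFrey hn,
    Nat.factorization_mul (pow_ne_zero _ two_ne_zero) (pow_ne_zero _ (mersenne_ne_zero (by omega)))]
  simp [Nat.factorization_pow, Nat.prime_two.factorization, hp2]

/-- **The valuation product of the family, exactly.**
`T(mersenneFrey n) = (2n - 8) · ∏_{p ∣ 2ⁿ-1} 2 v_p(2ⁿ - 1)`. -/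
theorem multiplicativeValuationProduct_mersenneFrey (hn : 5 ≤ n) :
    multiplicativeValuationProduct (mersenneFrey n) =
      (2 * n - 8) * ∏ p ∈ (mersenne n).primeFactors, 2 * (mersenne n).factorization p := by
  rw [multiplicativeValuationProduct_eq_of_squarefree _ (squarefree_conductorNorm_mersenneFrey hn),
    primeFactors_conductorNorm_mersenneFrey hn,
    Finset.prod_insert (two_notMem_primeFactors_mersenne (by omega)),
    factorization_two_minimalDiscriminantNorm_mersenneFrey hn]
  congr 1
  exact Finset.prod_congr rfl fun p hp => factorization_odd_minimalDiscriminantNorm_mersenneFrey hn hp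

/-- **Lower bound along the family**: `T(mersenneFrey n) ≥ 2n - 8 (> 2 log₂ N - 10)`. -/
theorem le_multiplicativeValuationProduct_mersenneFrey (hn : 5 ≤ n) :
    2 * n - 8 ≤ multiplicativeValuationProduct (mersenneFrey n) := by
  rw [multiplicativeValuationProduct_mersenneFrey hn]
  refine Nat.le_mul_of_pos_right _ (Finset.prod_pos fun p hp => ?_)
  have := (Nat.prime_of_mem_primeFactors hp).factorization_pos_of_dvd (mersenne_ne_zero (by omega))
    (Nat.dvd_of_mem_primeFactors hp)
  omega

/-- The family satisfies the crux's first hypothesis (semistable away from `2`; in fact everywhere). -/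
theorem mersenneFrey_hyp₁ (hn : 5 ≤ n) :
    ∀ p : ℕ, p.Prime → p ≠ 2 → ¬ p ^ 2 ∣ (mersenneFrey n).conductorNorm ℤ := by
  intro p hp _ h
  exact Nat.squarefree_iff_prime_squarefree.mp (squarefree_conductorNorm_mersenneFrey hn) p hp
    (by simpa [sq] using h)

/-- The crux's set of odd multiplicative primes is, for the family, exactly the set of prime factors
of `2ⁿ - 1`; so `mersenneFrey n` is in the FEW-prime class iff `ω(2ⁿ - 1) ≤ 3` and in the
MANY-prime class iff `ω(2ⁿ - 1) ≥ 4`. -/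
theorem oddMultiplicativePrimes_mersenneFrey (hn : 5 ≤ n) :
    ((mersenneFrey n).conductorNorm ℤ).primeFactors.filter
        (fun p => p ≠ 2 ∧ ¬ p ^ 2 ∣ (mersenneFrey n).conductorNorm ℤ) =
      (mersenne n).primeFactors := by
  ext p
  simp only [Finset.mem_filter, primeFactors_conductorNorm_mersenneFrey hn, Finset.mem_insert]
  constructor
  · rintro ⟨h | h, hp2, -⟩
    · exact absurd h hp2
    · exact h
  · intro h
    have hp2 : p ≠ 2 := fun h2 => two_notMem_primeFactors_mersenne (n := n) (by omega) (h2 ▸ h)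
    exact ⟨Or.inr h, hp2, mersenneFrey_hyp₁ hn p (Nat.prime_of_mem_primeFactors h) hp2⟩

end Family

/-! ## §2 Load-bearing analysis of `ε > 0` (hypothesis H_ε)

`FewPrimeBound 0` is "the crux with `ε` dropped": a UNIFORM bound `T(E) ≤ C` on the few-prime class.
At truth level it is false (Goldbach–Chen: `2ⁿ = ℓ + P₂` puts a Frey curve with `v₂(Δ_min) = 2n-8`
and `≤ 3` odd bad primes in the class for every large `n`), but every such family needs a sieve
theorem absent from Mathlib; what IS checkable is the reduction to the arithmetic input, the
unconditional failure for the sibling classes, and explicit members with large `T`. -/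

/-- **H_ε is load-bearing (conditional form).** If `ω(2ⁿ - 1) ≤ 3` for arbitrarily large `n` (e.g. if
there are infinitely many Mersenne primes — Lenstra–Pomerance–Wagstaff), the crux with `ε = 0` is
false: `T(mersenneFrey n) ≥ 2n - 8` is unbounded on the few-prime class. -/
theorem not_fewPrimeBound_zero_of_frequently_omega_le_three
    (H : ∀ N : ℕ, ∃ n, N ≤ n ∧ (mersenne n).primeFactors.card ≤ 3) : ¬ FewPrimeBound 0 := by
  rintro ⟨C, hC⟩
  obtain ⟨n, hn, hω⟩ := H (⌈C⌉₊ + 5)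
  haveI := isElliptic_mersenneFrey (n := n) (by omega)
  have h := hC (mersenneFrey n) (mersenneFrey_hyp₁ (by omega))
    (by rw [oddMultiplicativePrimes_mersenneFrey (by omega)]; exact hω)
  rw [Real.rpow_zero, mul_one] at h
  have hT : ((2 * n - 8 : ℕ) : ℝ) ≤ multiplicativeValuationProduct (mersenneFrey n) := by
    exact_mod_cast le_multiplicativeValuationProduct_mersenneFrey (n := n) (by omega)
  have h2 : (⌈C⌉₊ : ℝ) < (2 * n - 8 : ℕ) := by exact_mod_cast (by omega : ⌈C⌉₊ < 2 * n - 8)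
  have h3 : C ≤ ⌈C⌉₊ := Nat.le_ceil C
  linarith

/-- The sibling crux `ManyPrimeValuationProduct` (stmt-ABC-1561) at a fixed exponent. -/
def ManyPrimeBound (ε : ℝ) : Prop :=
  ∃ C : ℝ, ∀ (W : WeierstrassCurve ℚ) [W.IsElliptic],
    (∀ p : ℕ, p.Prime → p ≠ 2 → ¬ p ^ 2 ∣ W.conductorNorm ℤ) →
    4 ≤ ((W.conductorNorm ℤ).primeFactors.filter
        (fun p => p ≠ 2 ∧ ¬ p ^ 2 ∣ W.conductorNorm ℤ)).card →
    (multiplicativeValuationProduct W : ℝ) ≤ C * (W.conductorNorm ℤ : ℝ) ^ ε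

theorem manyPrimeValuationProduct_iff :
    ManyPrimeValuationProduct ↔ ∀ ε : ℝ, 0 < ε → ManyPrimeBound ε := Iff.rfl

/-- The crux with hypothesis H_card (`≤ 3` odd multiplicative primes) dropped = the union of the two
cruxes = Pasten's Conjecture 1.14 shape for curves semistable away from `2`, at a fixed exponent. -/
def ValuationProductBound (ε : ℝ) : Prop :=
  ∃ C : ℝ, ∀ (W : WeierstrassCurve ℚ) [W.IsElliptic],
    (∀ p : ℕ, p.Prime → p ≠ 2 → ¬ p ^ 2 ∣ W.conductorNorm ℤ) →
    (multiplicativeValuationProduct W : ℝ) ≤ C * (W.conductorNorm ℤ : ℝ) ^ ε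

theorem valuationProductBound_iff (ε : ℝ) :
    ValuationProductBound ε ↔ FewPrimeBound ε ∧ ManyPrimeBound ε := by
  constructor
  · rintro ⟨C, hC⟩
    exact ⟨⟨C, fun W _ h₁ _ => hC W h₁⟩, ⟨C, fun W _ h₁ _ => hC W h₁⟩⟩
  · rintro ⟨⟨C₁, h₁⟩, ⟨C₂, h₂⟩⟩
    refine ⟨max C₁ C₂, fun W _ hW => ?_⟩
    have hN : 0 ≤ (W.conductorNorm ℤ : ℝ) ^ ε := Real.rpow_nonneg (Nat.cast_nonneg _) _
    rcases le_or_gt ((W.conductorNorm ℤ).primeFactors.filter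
        (fun p => p ≠ 2 ∧ ¬ p ^ 2 ∣ W.conductorNorm ℤ)).card 3 with h | h
    · exact (h₁ W hW h).trans (mul_le_mul_of_nonneg_right (le_max_left _ _) hN)
    · exact (h₂ W hW h).trans (mul_le_mul_of_nonneg_right (le_max_right _ _) hN)

/-- `4095 = 2¹² - 1 = 3² · 5 · 7 · 13` has four prime factors, all dividing `2¹²ᵏ - 1`. -/
private theorem four_le_card_primeFactors_mersenne (k : ℕ) (hk : 1 ≤ k) :
    4 ≤ (mersenne (12 * k)).primeFactors.card := by
  have hdvd : mersenne 12 ∣ mersenne (12 * k) := by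
    simpa only [mersenne, one_pow, pow_mul] using Nat.sub_dvd_pow_sub_pow (2 ^ 12) 1 k
  have hsub : ({3, 5, 7, 13} : Finset ℕ) ⊆ (mersenne (12 * k)).primeFactors := by
    intro p hp
    simp only [Finset.mem_insert, Finset.mem_singleton] at hp
    have hm : mersenne (12 * k) ≠ 0 := mersenne_ne_zero (by omega)
    have h12 : mersenne 12 = 4095 := by norm_num [mersenne]
    rw [h12] at hdvd
    rcases hp with rfl | rfl | rfl | rfl <;>
      exact Nat.mem_primeFactors.mpr ⟨by norm_num, dvd_trans (by norm_num) hdvd, hm⟩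
  exact le_trans (by decide) (Finset.card_le_card hsub)

/-- **Unconditionally, `ε` cannot be dropped from the sibling crux `ManyPrimeValuationProduct`**:
`mersenneFrey (12k)` has `≥ 4` odd multiplicative primes (`3, 5, 7, 13`) and `T ≥ 24k - 8`. -/
theorem not_manyPrimeBound_zero : ¬ ManyPrimeBound 0 := by
  rintro ⟨C, hC⟩
  set n := 12 * (⌈C⌉₊ + 1) with hn
  have hn5 : 5 ≤ n := by omega
  haveI := isElliptic_mersenneFrey (n := n) (by omega)
  have h := hC (mersenneFrey n) (mersenneFrey_hyp₁ hn5)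
    (by rw [oddMultiplicativePrimes_mersenneFrey hn5]
        exact four_le_card_primeFactors_mersenne _ (by omega))
  rw [Real.rpow_zero, mul_one] at h
  have hT : ((2 * n - 8 : ℕ) : ℝ) ≤ multiplicativeValuationProduct (mersenneFrey n) := by
    exact_mod_cast le_multiplicativeValuationProduct_mersenneFrey hn5
  have h2 : (⌈C⌉₊ : ℝ) < (2 * n - 8 : ℕ) := by exact_mod_cast (by omega : ⌈C⌉₊ < 2 * n - 8)
  have h3 : C ≤ ⌈C⌉₊ := Nat.le_ceil C
  linarith

/-- **Unconditionally, `ε` cannot be dropped once H_card is dropped** (the union of the two cruxes,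
Pasten's Conjecture 1.14 shape, needs its `ε`): immediate from `not_manyPrimeBound_zero`. So the
crux's OWN `ε = 0` failure is conditional only because membership of `mersenneFrey n` in the
FEW-prime class is the open question `ω(2ⁿ - 1) ≤ 3` infinitely often. -/
theorem not_valuationProductBound_zero : ¬ ValuationProductBound 0 :=
  fun h => not_manyPrimeBound_zero ((valuationProductBound_iff 0).mp h).2

/-! ### Explicit members of the few-prime class with large `T` -/

/-- `rad p = p` for a prime `p`. [folklore] -/
private theorem radical_prime {p : ℕ} (hp : p.Prime) : radical p = p := by
  rw [Nat.radical_eq_prod_primeFactors, hp.primeFactors, Finset.prod_singleton]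

/-- `∏_{q ∣ p} 2 v_q(p) = 2` for a prime `p`. [folklore] -/
private theorem prod_prime {p : ℕ} (hp : p.Prime) :
    ∏ q ∈ p.primeFactors, 2 * p.factorization q = 2 := by
  rw [hp.primeFactors, Finset.prod_singleton, hp.factorization_self]

/-- `n = 13` (`2¹³ - 1 = 8191` prime): the curve `y² = x(x+1)(x+2¹³)` is semistable with bad primes
`{2, 8191}` (ONE odd multiplicative prime), `N = 16382`, and `T = 18 · 2 = 36` — already seven times
Mestre–Oesterlé's uniform `v_p(Δ) ≤ 5` of the prime-conductor case. -/
theorem fewPrime_witness_13 :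
    (mersenneFrey 13).IsElliptic ∧
    (∀ p : ℕ, p.Prime → p ≠ 2 → ¬ p ^ 2 ∣ (mersenneFrey 13).conductorNorm ℤ) ∧
    (((mersenneFrey 13).conductorNorm ℤ).primeFactors.filter
        (fun p => p ≠ 2 ∧ ¬ p ^ 2 ∣ (mersenneFrey 13).conductorNorm ℤ)).card = 1 ∧
    (mersenneFrey 13).conductorNorm ℤ = 16382 ∧
    multiplicativeValuationProduct (mersenneFrey 13) = 36 := by
  have hp : (mersenne 13).Prime := by norm_num [mersenne]
  have h5 : 5 ≤ 13 := by norm_num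
  refine ⟨isElliptic_mersenneFrey (by norm_num), mersenneFrey_hyp₁ h5, ?_, ?_, ?_⟩
  · rw [oddMultiplicativePrimes_mersenneFrey h5, hp.primeFactors, Finset.card_singleton]
  · rw [conductorNorm_mersenneFrey_eq h5, radical_prime hp]; norm_num [mersenne]
  · rw [multiplicativeValuationProduct_mersenneFrey h5, prod_prime hp]

/-- `n = 127` (`2¹²⁷ - 1` prime, Lucas–Lehmer in the kernel): `N = 2 (2¹²⁷ - 1)`, ONE odd
multiplicative prime, `T = 246 · 2 = 492`. -/
theorem fewPrime_witness_127 :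
    (mersenneFrey 127).IsElliptic ∧
    (∀ p : ℕ, p.Prime → p ≠ 2 → ¬ p ^ 2 ∣ (mersenneFrey 127).conductorNorm ℤ) ∧
    (((mersenneFrey 127).conductorNorm ℤ).primeFactors.filter
        (fun p => p ≠ 2 ∧ ¬ p ^ 2 ∣ (mersenneFrey 127).conductorNorm ℤ)).card = 1 ∧
    (mersenneFrey 127).conductorNorm ℤ = 2 * mersenne 127 ∧
    multiplicativeValuationProduct (mersenneFrey 127) = 492 := by
  have hp : (mersenne 127).Prime := lucas_lehmer_sufficiency _ (by norm_num) (by norm_num)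
  have h5 : 5 ≤ 127 := by norm_num
  refine ⟨isElliptic_mersenneFrey (by norm_num), mersenneFrey_hyp₁ h5, ?_, ?_, ?_⟩
  · rw [oddMultiplicativePrimes_mersenneFrey h5, hp.primeFactors, Finset.card_singleton]
  · rw [conductorNorm_mersenneFrey_eq h5, radical_prime hp]
  · rw [multiplicativeValuationProduct_mersenneFrey h5, prod_prime hp]

/-- **Any uniform constant for the few-prime class is at least `492`** (refutes every explicit
strengthening `T(E) ≤ c`, `c < 492`, in particular the verbatim extension of Mestre–Oesterlé's
`v_p(Δ_min) ≤ 5` from prime conductor to the few-prime class). -/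
theorem fewPrimeBound_zero_const_ge {C : ℝ}
    (hC : ∀ (W : WeierstrassCurve ℚ) [W.IsElliptic],
      (∀ p : ℕ, p.Prime → p ≠ 2 → ¬ p ^ 2 ∣ W.conductorNorm ℤ) →
      ((W.conductorNorm ℤ).primeFactors.filter
          (fun p => p ≠ 2 ∧ ¬ p ^ 2 ∣ W.conductorNorm ℤ)).card ≤ 3 →
      (multiplicativeValuationProduct W : ℝ) ≤ C) :
    492 ≤ C := by
  obtain ⟨hE, h₁, hcard, -, hT⟩ := fewPrime_witness_127
  haveI := hE
  have h := hC (mersenneFrey 127) h₁ (by omega)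
  rw [hT] at h
  exact_mod_cast h

/-- The naive few-prime extension of Mestre–Oesterlé (`T(E) ≤ 5` whenever `E` is semistable away
from `2` with `≤ 3` odd multiplicative primes) is false. -/
theorem not_fewPrime_le_five :
    ¬ ∀ (W : WeierstrassCurve ℚ) [W.IsElliptic],
      (∀ p : ℕ, p.Prime → p ≠ 2 → ¬ p ^ 2 ∣ W.conductorNorm ℤ) →
      ((W.conductorNorm ℤ).primeFactors.filter
          (fun p => p ≠ 2 ∧ ¬ p ^ 2 ∣ W.conductorNorm ℤ)).card ≤ 3 →
      multiplicativeValuationProduct W ≤ 5 := by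
  intro h
  obtain ⟨hE, h₁, hcard, -, hT⟩ := fewPrime_witness_13
  haveI := hE
  have := h (mersenneFrey 13) h₁ (by omega)
  omega

/-! ### General Serre-normalised Frey curves and small explicit witnesses with `T > N` -/

section SerreFrey

variable {a b : ℤ}

/-- For a Serre-normalised Frey curve (`a ≡ -1 (4)`, `32 ∣ b`, coprime, `ab(a+b) ≠ 0`) with
`m := |ab(a+b)|`: `N = rad m` (in `ℕ`). -/
theorem conductorNorm_freyCurve_serre (hab : IsCoprime a b) (h0 : a * b * (a + b) ≠ 0)
    (ha : a ≡ -1 [ZMOD 4]) (hb : (32 : ℤ) ∣ b) :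
    (freyCurve a b).conductorNorm ℤ = radical (a * b * (a + b)).natAbs := by
  rw [conductorNorm_freyCurve_of_mod_holds a b hab h0 ha hb, ← Int.radical_natAbs_eq_radical,
    Int.natAbs_natCast]

/-- … and `2⁸ Δ_min = m²`. -/
theorem minimalDiscriminantNorm_freyCurve_serre (hab : IsCoprime a b) (h0 : a * b * (a + b) ≠ 0)
    (ha : a ≡ -1 [ZMOD 4]) (hb : (32 : ℤ) ∣ b) :
    2 ^ 8 * (freyCurve a b).minimalDiscriminantNorm ℤ = (a * b * (a + b)).natAbs ^ 2 := by
  rw [minimalDiscriminantNorm_freyCurve_of_mod_holds a b hab h0 ha hb, Int.natAbs_pow]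

/-- … hence `v_p(Δ_min) = 2 v_p(m) - 8·[p = 2]`. -/
theorem factorization_minimalDiscriminantNorm_freyCurve_serre (hab : IsCoprime a b)
    (h0 : a * b * (a + b) ≠ 0) (ha : a ≡ -1 [ZMOD 4]) (hb : (32 : ℤ) ∣ b) (p : ℕ) :
    ((freyCurve a b).minimalDiscriminantNorm ℤ).factorization p =
      2 * (a * b * (a + b)).natAbs.factorization p - if p = 2 then 8 else 0 := by
  have h : (2 ^ 8 * (freyCurve a b).minimalDiscriminantNorm ℤ).factorization p =
      ((a * b * (a + b)).natAbs ^ 2).factorization p := by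
    rw [minimalDiscriminantNorm_freyCurve_serre hab h0 ha hb]
  have hΔ : (freyCurve a b).minimalDiscriminantNorm ℤ ≠ 0 := by
    intro h0'
    rw [h0', mul_zero, Nat.factorization_zero] at h
    have hm : (a * b * (a + b)).natAbs ≠ 0 := Int.natAbs_ne_zero.mpr h0
    have := minimalDiscriminantNorm_freyCurve_serre hab h0 ha hb
    rw [h0', mul_zero] at this
    exact pow_ne_zero 2 hm this.symm
  rw [Nat.factorization_mul (by positivity) hΔ, Nat.factorization_pow, Nat.factorization_pow] at h
  simp only [Finsupp.add_apply, Finsupp.smul_apply, smul_eq_mul, Nat.prime_two.factorization,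
    Finsupp.single_apply] at h
  split_ifs with hp
  · subst hp; simp at h; omega
  · rw [if_neg (Ne.symm hp)] at h; omega

/-- … and `T = ∏_{p ∣ m} (2 v_p(m) - 8·[p = 2])`. -/
theorem multiplicativeValuationProduct_freyCurve_serre (hab : IsCoprime a b)
    (h0 : a * b * (a + b) ≠ 0) (ha : a ≡ -1 [ZMOD 4]) (hb : (32 : ℤ) ∣ b) :
    multiplicativeValuationProduct (freyCurve a b) =
      ∏ p ∈ (a * b * (a + b)).natAbs.primeFactors,
        (2 * (a * b * (a + b)).natAbs.factorization p - if p = 2 then 8 else 0) := by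
  have hN := conductorNorm_freyCurve_serre hab h0 ha hb
  rw [multiplicativeValuationProduct_eq_of_squarefree _ (by rw [hN]; exact squarefree_radical), hN,
    Nat.primeFactors_radical]
  exact Finset.prod_congr rfl fun p _ =>
    factorization_minimalDiscriminantNorm_freyCurve_serre hab h0 ha hb p

/-- The crux hypotheses for a Serre-normalised Frey curve: semistable, and the odd multiplicative
primes are the odd prime factors of `m`. -/
theorem freyCurve_serre_hyp₁ (hab : IsCoprime a b) (h0 : a * b * (a + b) ≠ 0)
    (ha : a ≡ -1 [ZMOD 4]) (hb : (32 : ℤ) ∣ b) :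
    ∀ p : ℕ, p.Prime → p ≠ 2 → ¬ p ^ 2 ∣ (freyCurve a b).conductorNorm ℤ := by
  intro p hp _ h
  have hsq : Squarefree ((freyCurve a b).conductorNorm ℤ) := by
    rw [conductorNorm_freyCurve_serre hab h0 ha hb]; exact squarefree_radical
  exact Nat.squarefree_iff_prime_squarefree.mp hsq p hp (by simpa [sq] using h)

theorem oddMultiplicativePrimes_freyCurve_serre (hab : IsCoprime a b) (h0 : a * b * (a + b) ≠ 0)
    (ha : a ≡ -1 [ZMOD 4]) (hb : (32 : ℤ) ∣ b) :
    ((freyCurve a b).conductorNorm ℤ).primeFactors.filter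
        (fun p => p ≠ 2 ∧ ¬ p ^ 2 ∣ (freyCurve a b).conductorNorm ℤ) =
      (a * b * (a + b)).natAbs.primeFactors.erase 2 := by
  ext p
  rw [Finset.mem_filter, Finset.mem_erase, conductorNorm_freyCurve_serre hab h0 ha hb,
    Nat.primeFactors_radical]
  constructor
  · rintro ⟨h, hp2, -⟩; exact ⟨hp2, h⟩
  · rintro ⟨hp2, h⟩
    refine ⟨h, hp2, ?_⟩
    have := freyCurve_serre_hyp₁ hab h0 ha hb p (Nat.prime_of_mem_primeFactors h) hp2
    rwa [conductorNorm_freyCurve_serre hab h0 ha hb] at this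

/-- **`13 + 3⁵ = 2⁸`**: the Frey curve `freyCurve (-13) 256` (`y² = x(x+13)(x+256)`) has `N = 78`,
two odd multiplicative primes, and `T = v₂·v₃·v₁₃ = 8·10·2 = 160 > N` — so even at `ε = 1` the
constant must exceed `2`: the explicit strengthening "`T(E) ≤ N_E`" of the crux is false. -/
theorem fewPrime_witness_13_243_256 :
    (freyCurve (-13) 256).IsElliptic ∧
    (∀ p : ℕ, p.Prime → p ≠ 2 → ¬ p ^ 2 ∣ (freyCurve (-13) 256).conductorNorm ℤ) ∧
    (((freyCurve (-13) 256).conductorNorm ℤ).primeFactors.filter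
        (fun p => p ≠ 2 ∧ ¬ p ^ 2 ∣ (freyCurve (-13) 256).conductorNorm ℤ)).card = 2 ∧
    (freyCurve (-13) 256).conductorNorm ℤ = 78 ∧
    multiplicativeValuationProduct (freyCurve (-13) 256) = 160 := by
  have hab : IsCoprime (-13 : ℤ) 256 := by rw [Int.isCoprime_iff_gcd_eq_one]; norm_num
  have h0 : (-13 : ℤ) * 256 * (-13 + 256) ≠ 0 := by norm_num
  have ha : (-13 : ℤ) ≡ -1 [ZMOD 4] := by decide
  have hb : (32 : ℤ) ∣ 256 := by norm_num
  have hm : ((-13 : ℤ) * 256 * (-13 + 256)).natAbs = 808704 := by norm_num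
  have hpf : Nat.primeFactors 808704 = {2, 3, 13} := by
    rw [← Nat.toFinset_factors]
    simp only [Nat.primeFactorsList_ofNat]
    decide
  have hf : ∀ p, Nat.factorization 808704 p =
      List.count p [2, 2, 2, 2, 2, 2, 2, 2, 3, 3, 3, 3, 3, 13] := by
    intro p
    rw [← Nat.primeFactorsList_count_eq]
    simp only [Nat.primeFactorsList_ofNat]
  refine ⟨isElliptic_freyCurve h0, freyCurve_serre_hyp₁ hab h0 ha hb, ?_, ?_, ?_⟩
  · rw [oddMultiplicativePrimes_freyCurve_serre hab h0 ha hb, hm, hpf]; decide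
  · rw [conductorNorm_freyCurve_serre hab h0 ha hb, hm, Nat.radical_eq_prod_primeFactors, hpf]; decide
  · rw [multiplicativeValuationProduct_freyCurve_serre hab h0 ha hb, hm, hpf]
    simp only [hf]
    decide

/-- The explicit strengthening `T(E) ≤ N_E` (i.e. `C = 1`, `ε = 1`) of the crux is false. -/
theorem not_fewPrime_le_conductor :
    ¬ ∀ (W : WeierstrassCurve ℚ) [W.IsElliptic],
      (∀ p : ℕ, p.Prime → p ≠ 2 → ¬ p ^ 2 ∣ W.conductorNorm ℤ) →
      ((W.conductorNorm ℤ).primeFactors.filter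
          (fun p => p ≠ 2 ∧ ¬ p ^ 2 ∣ W.conductorNorm ℤ)).card ≤ 3 →
      multiplicativeValuationProduct W ≤ W.conductorNorm ℤ := by
  intro h
  obtain ⟨hE, h₁, hcard, hN, hT⟩ := fewPrime_witness_13_243_256
  haveI := hE
  have := h (freyCurve (-13) 256) h₁ (by omega)
  rw [hN, hT] at this
  omega

end SerreFrey

/-! ### Frey curves of `a + 2ⁿ` and the UNCONDITIONAL `ε`-drop via Chen's theorem

Chen's theorem in Goldbach form is PROVED in the tree
(`Literature.NumberTheory.Sieve.chen_goldbach_holds`, kernel-closed, standard axioms): every large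
even number is `ℓ + m`, `ℓ` prime, `Ω(m) ≤ 2`. Applied to `2ⁿ` it puts, for every large `n`, a
Serre-normalised Frey curve `freyCurve a (2ⁿ)` (`a = -ℓ` or `-m`, whichever is `≡ 1 (mod 4)`, or the
Mersenne–Frey curve of `n - 1` when `ℓ = 2`) with `≤ 3` odd multiplicative primes and `T ≥ 2n - 10`
into the few-prime class. Hence H_ε is load-bearing UNCONDITIONALLY. -/

section TwoPow

/-- An integer `≡ -1 (mod 4)` is coprime to every power of `2`. -/
private theorem isCoprime_two_pow_of_mod {a : ℤ} (ha : a ≡ -1 [ZMOD 4]) (n : ℕ) :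
    IsCoprime a (2 ^ n) := by
  have h4 : (4 : ℤ) ∣ -1 - a := Int.ModEq.dvd ha
  obtain ⟨k, hk⟩ := h4
  have : IsCoprime a 2 := ⟨-1, -(2 * k), by linarith⟩
  exact this.pow_right

/-- `ω(n) ≤ Ω(n)`: distinct prime factors versus prime factors with multiplicity. -/
private theorem card_primeFactors_le_cardFactors (m : ℕ) :
    m.primeFactors.card ≤ ArithmeticFunction.cardFactors m := by
  rw [← Nat.toFinset_factors, ArithmeticFunction.cardFactors_apply]
  exact List.toFinset_card_le _

/-- **Frey curve of `a + 2ⁿ`** (`a ≡ -1 (mod 4)`, `n ≥ 5`, `a + 2ⁿ ≠ 0`): it is in the class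
"semistable away from `2`" with at most `ω(|a|) + ω(|a + 2ⁿ|)` odd multiplicative primes, and
`T ≥ 2n - 8` (the factor at the multiplicative prime `2`, where `v₂(Δ_min) = 2n - 8`). -/
theorem freyCurve_two_pow_spec {a : ℤ} {n : ℕ} (ha : a ≡ -1 [ZMOD 4]) (hn : 5 ≤ n)
    (hc : a + 2 ^ n ≠ 0) :
    (freyCurve a (2 ^ n)).IsElliptic ∧
    (∀ p : ℕ, p.Prime → p ≠ 2 → ¬ p ^ 2 ∣ (freyCurve a (2 ^ n)).conductorNorm ℤ) ∧
    (((freyCurve a (2 ^ n)).conductorNorm ℤ).primeFactors.filter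
        (fun p => p ≠ 2 ∧ ¬ p ^ 2 ∣ (freyCurve a (2 ^ n)).conductorNorm ℤ)).card ≤
      a.natAbs.primeFactors.card + (a + 2 ^ n).natAbs.primeFactors.card ∧
    2 * n - 8 ≤ multiplicativeValuationProduct (freyCurve a (2 ^ n)) := by
  have ha0 : a ≠ 0 := by
    rintro rfl
    exact absurd (Int.ModEq.dvd ha) (by decide)
  have hodd : ¬ (2 : ℤ) ∣ a := by
    intro h2
    have h4 : (4 : ℤ) ∣ -1 - a := Int.ModEq.dvd ha
    omega
  have hab : IsCoprime a (2 ^ n) := isCoprime_two_pow_of_mod ha n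
  have h0 : a * 2 ^ n * (a + 2 ^ n) ≠ 0 := mul_ne_zero (mul_ne_zero ha0 (by positivity)) hc
  have hb : (32 : ℤ) ∣ 2 ^ n := by
    rw [show (32 : ℤ) = 2 ^ 5 by norm_num]; exact pow_dvd_pow 2 hn
  set M := (a * 2 ^ n * (a + 2 ^ n)).natAbs with hM
  have hM0 : M ≠ 0 := Int.natAbs_ne_zero.mpr h0
  have hMeq : M = a.natAbs * 2 ^ n * (a + 2 ^ n).natAbs := by
    rw [hM, Int.natAbs_mul, Int.natAbs_mul, Int.natAbs_pow]; rfl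
  have hodd' : ¬ 2 ∣ a.natAbs := fun h => hodd (by exact_mod_cast Int.natCast_dvd.mpr h)
  have hcodd : ¬ (2 : ℤ) ∣ a + 2 ^ n := by
    intro h
    exact hodd ((Int.dvd_add_left (dvd_pow_self 2 (by omega))).mp h)
  have hcodd' : ¬ 2 ∣ (a + 2 ^ n).natAbs := fun h =>
    hcodd (by exact_mod_cast Int.natCast_dvd.mpr h)
  -- v₂(M) = n
  have hM2 : M.factorization 2 = n := by
    rw [hMeq, Nat.factorization_mul (mul_ne_zero (Int.natAbs_ne_zero.mpr ha0) (by positivity))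
      (Int.natAbs_ne_zero.mpr hc), Nat.factorization_mul (Int.natAbs_ne_zero.mpr ha0) (by positivity)]
    simp [Nat.factorization_eq_zero_of_not_dvd hodd', Nat.factorization_eq_zero_of_not_dvd hcodd',
      Nat.prime_two.factorization_self]
  have h2M : 2 ∈ M.primeFactors :=
    Nat.mem_primeFactors.mpr ⟨Nat.prime_two, by
      rw [hMeq]; exact dvd_mul_of_dvd_left (dvd_mul_of_dvd_right (dvd_pow_self 2 (by omega)) _) _,
      hM0⟩
  refine ⟨isElliptic_freyCurve h0, freyCurve_serre_hyp₁ hab h0 ha hb, ?_, ?_⟩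
  · -- odd multiplicative primes ⊆ primeFactors |a| ∪ primeFactors |a + 2ⁿ|
    rw [oddMultiplicativePrimes_freyCurve_serre hab h0 ha hb]
    refine le_trans (Finset.card_le_card ?_) (Finset.card_union_le _ _)
    intro p hp
    rw [Finset.mem_erase] at hp
    obtain ⟨hp2, hp⟩ := hp
    have hpp := Nat.prime_of_mem_primeFactors hp
    have hdvd := Nat.dvd_of_mem_primeFactors hp
    rw [← hM, hMeq] at hdvd
    rw [Finset.mem_union, Nat.mem_primeFactors, Nat.mem_primeFactors]
    rcases (Nat.Prime.dvd_mul hpp).mp hdvd with h | h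
    · rcases (Nat.Prime.dvd_mul hpp).mp h with h | h
      · exact Or.inl ⟨hpp, h, Int.natAbs_ne_zero.mpr ha0⟩
      · exact absurd ((Nat.prime_dvd_prime_iff_eq hpp Nat.prime_two).mp (hpp.dvd_of_dvd_pow h)) hp2
    · exact Or.inr ⟨hpp, h, Int.natAbs_ne_zero.mpr hc⟩
  · -- T ≥ the factor at p = 2
    rw [multiplicativeValuationProduct_freyCurve_serre hab h0 ha hb, ← hM,
      ← Finset.mul_prod_erase _ _ h2M, if_pos rfl, hM2]
    refine Nat.le_mul_of_pos_right _ (Finset.prod_pos fun p hp => ?_)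
    rw [Finset.mem_erase] at hp
    rw [if_neg hp.1]
    have := (Nat.prime_of_mem_primeFactors hp.2).factorization_pos_of_dvd hM0
      (Nat.dvd_of_mem_primeFactors hp.2)
    omega

/-- **H_ε is load-bearing, UNCONDITIONALLY**: the crux with `ε = 0` (a uniform bound `T(E) ≤ C` on
the few-prime class) is FALSE. For large `n`, Chen (`chen_goldbach_holds`): `2ⁿ = ℓ + m`, `ℓ` prime,
`Ω(m) ≤ 2`. If `ℓ = 2` then `2ⁿ⁻¹ - 1 ∣ m` has `≤ 2` prime factors and the Mersenne–Frey curve of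
`n - 1` has `T ≥ 2n - 10`; if `ℓ` is odd, the Frey curve `freyCurve a (2ⁿ)` with `a = -ℓ`
(`ℓ ≡ 1 (4)`) or `a = -m` (`ℓ ≡ 3 (4)`, so `m ≡ 1 (4)`) has `≤ 1 + 2` odd multiplicative primes and
`T ≥ 2n - 8`. -/
theorem not_fewPrimeBound_zero : ¬ FewPrimeBound 0 := by
  rintro ⟨C, hC⟩
  simp only [Real.rpow_zero, mul_one] at hC
  obtain ⟨N₀, hN₀⟩ := Literature.NumberTheory.Sieve.chen_goldbach_holds
  set n := N₀ + ⌈C⌉₊ + 6 with hn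
  have hnN : N₀ ≤ 2 ^ n := le_trans (by omega) (Nat.lt_two_pow_self).le
  have heven : Even (2 ^ n) := (Nat.even_pow' (by omega)).mpr even_two
  obtain ⟨ℓ, m, hℓ, ⟨hm0, hΩ⟩, hsum⟩ := hN₀ (2 ^ n) hnN heven
  have hωm : m.primeFactors.card ≤ 2 := (card_primeFactors_le_cardFactors m).trans hΩ
  have hC' : C < (2 * n - 10 : ℕ) := by
    have h1 : C ≤ ⌈C⌉₊ := Nat.le_ceil C
    have h2 : (⌈C⌉₊ : ℝ) < (2 * n - 10 : ℕ) := by exact_mod_cast (by omega : ⌈C⌉₊ < 2 * n - 10)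
    linarith
  -- a member of the few-prime class with `T ≥ 2n - 10` contradicts `hC`
  suffices h : ∃ (W : WeierstrassCurve ℚ), W.IsElliptic ∧
      (∀ p : ℕ, p.Prime → p ≠ 2 → ¬ p ^ 2 ∣ W.conductorNorm ℤ) ∧
      ((W.conductorNorm ℤ).primeFactors.filter
          (fun p => p ≠ 2 ∧ ¬ p ^ 2 ∣ W.conductorNorm ℤ)).card ≤ 3 ∧
      2 * n - 10 ≤ multiplicativeValuationProduct W by
    obtain ⟨W, hE, h₁, hcard, hT⟩ := h
    haveI := hE
    have h := hC W h₁ hcard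
    have hT' : ((2 * n - 10 : ℕ) : ℝ) ≤ multiplicativeValuationProduct W := by exact_mod_cast hT
    linarith
  by_cases hℓ2 : ℓ = 2
  · -- `m = 2ⁿ - 2 = 2 (2ⁿ⁻¹ - 1)`: the Mersenne–Frey curve of `n - 1`
    subst hℓ2
    have hdvd : mersenne (n - 1) ∣ m := by
      refine ⟨2, ?_⟩
      have h2n : 2 ^ n = 2 * 2 ^ (n - 1) := by
        rw [← pow_succ', Nat.sub_add_cancel (by omega : 1 ≤ n)]
      simp only [mersenne]
      have : 1 ≤ 2 ^ (n - 1) := Nat.one_le_two_pow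
      omega
    have hω : (mersenne (n - 1)).primeFactors.card ≤ 3 :=
      (Finset.card_le_card (Nat.primeFactors_mono hdvd hm0)).trans (hωm.trans (by norm_num))
    refine ⟨mersenneFrey (n - 1), isElliptic_mersenneFrey (by omega), mersenneFrey_hyp₁ (by omega),
      by rw [oddMultiplicativePrimes_mersenneFrey (by omega)]; exact hω, ?_⟩
    have := le_multiplicativeValuationProduct_mersenneFrey (n := n - 1) (by omega)
    omega
  · -- `ℓ` odd
    have hℓodd : ℓ % 2 = 1 := by
      rcases Nat.even_or_odd ℓ with h | h
      · exact absurd (hℓ.even_iff.mp h) hℓ2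
      · exact Nat.odd_iff.mp h
    have h4 : 4 ∣ 2 ^ n := (pow_dvd_pow 2 (by omega : 2 ≤ n))
    have hωℓ : ℓ.primeFactors.card = 1 := by rw [hℓ.primeFactors, Finset.card_singleton]
    rcases Nat.odd_mod_four_iff.mp hℓodd with h1 | h3
    · -- `ℓ ≡ 1 (4)`: `a = -ℓ`, `a + 2ⁿ = m`
      have ha : (-(ℓ : ℤ)) ≡ -1 [ZMOD 4] := by
        have : (ℓ : ℤ) % 4 = 1 := by exact_mod_cast h1
        exact Int.ModEq.neg this
      have hc : -(ℓ : ℤ) + 2 ^ n = m := by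
        have := congrArg (fun k : ℕ => (k : ℤ)) hsum; push_cast at this; linarith
      have hc0 : -(ℓ : ℤ) + 2 ^ n ≠ 0 := by rw [hc]; exact_mod_cast hm0
      obtain ⟨hE, h₁, hcard, hT⟩ := freyCurve_two_pow_spec (n := n) ha (by omega) hc0
      have h810 : 2 * n - 10 ≤ 2 * n - 8 := by omega
      refine ⟨freyCurve (-(ℓ : ℤ)) (2 ^ n), hE, h₁, hcard.trans ?_, h810.trans hT⟩
      rw [hc, Int.natAbs_neg, Int.natAbs_natCast, Int.natAbs_natCast, hωℓ]
      omega
    · -- `ℓ ≡ 3 (4)`: `m ≡ 1 (4)`, `a = -m`, `a + 2ⁿ = ℓ`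
      have hm1 : m % 4 = 1 := by omega
      have ha : (-(m : ℤ)) ≡ -1 [ZMOD 4] := by
        have : (m : ℤ) % 4 = 1 := by exact_mod_cast hm1
        exact Int.ModEq.neg this
      have hc : -(m : ℤ) + 2 ^ n = ℓ := by
        have := congrArg (fun k : ℕ => (k : ℤ)) hsum; push_cast at this; linarith
      have hc0 : -(m : ℤ) + 2 ^ n ≠ 0 := by rw [hc]; exact_mod_cast hℓ.ne_zero
      obtain ⟨hE, h₁, hcard, hT⟩ := freyCurve_two_pow_spec (n := n) ha (by omega) hc0
      have h810 : 2 * n - 10 ≤ 2 * n - 8 := by omega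
      refine ⟨freyCurve (-(m : ℤ)) (2 ^ n), hE, h₁, hcard.trans ?_, h810.trans hT⟩
      rw [hc, Int.natAbs_neg, Int.natAbs_natCast, Int.natAbs_natCast, hωℓ]
      omega

end TwoPow

/-! ## §3 Why the crux resists refutation: it is a consequence of Szpiro's conjecture

Any refutation of `FewPrimeValuationProduct` is a refutation of `SzpiroConjecture`
(`Literature.NumberTheory.EllipticCurves.Szpiro`): with at most `4` multiplicative primes in the
product, each factor `v_p(Δ_min) ≤ log₂ |Δ_min| ≤ log₂ C + 7 log₂ N`, so `T ≤ (K_ε N^{ε/4})⁴`.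
The semistability hypothesis H_sf of the crux is NOT used: Szpiro gives the crux with H_sf dropped.

NOT VACUOUS: the tree's `conductorNorm` is the true conductor up to a factor dividing `2⁸·3⁵`
(discharged: `conductorExponent_eq_zero_iff_holds` / `_eq_one_iff_holds` /
`two_le_conductorExponent_iff_holds` fix the support and the reduction types,
`conductorExponent_le_two_of_five_le_natGenerator_holds` makes `f_p` exact for `p ≥ 5`,
`conductorExponent_le_eight_holds` / `conductorExponent_le_five_of_natGenerator_eq_three_holds`
bound `f₂ ≤ 8`, `f₃ ≤ 5`), and `minimalDiscriminantNorm` is `|Δ_min|` exactly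
(`minimalDiscriminantNorm_eq_natAbs_holds`); so the tree's `SzpiroConjecture` is equivalent to the
printed conjecture (constants absorb `2⁸·3⁵`), not a junk-false hypothesis. -/

/-- The crux with hypothesis H_sf (semistable away from `2`) dropped, at a fixed exponent: additive
odd primes are allowed (they do not enter the product, which runs over multiplicative primes). -/
def FewPrimeBoundWithoutSemistable (ε : ℝ) : Prop :=
  ∃ C : ℝ, ∀ (W : WeierstrassCurve ℚ) [W.IsElliptic],
    ((W.conductorNorm ℤ).primeFactors.filter
        (fun p => p ≠ 2 ∧ ¬ p ^ 2 ∣ W.conductorNorm ℤ)).card ≤ 3 →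
    (multiplicativeValuationProduct W : ℝ) ≤ C * (W.conductorNorm ℤ : ℝ) ^ ε

theorem FewPrimeBoundWithoutSemistable.toFewPrimeBound {ε : ℝ}
    (h : FewPrimeBoundWithoutSemistable ε) : FewPrimeBound ε := by
  obtain ⟨C, hC⟩ := h
  exact ⟨C, fun W _ _ hcard => hC W hcard⟩

/-- **Szpiro ⟹ the crux, even without H_sf.** From `|Δ_min| ≤ C N^7` (Szpiro at `ε = 1`):
`v_p(Δ_min) log 2 ≤ log C + 7 log N ≤ log C + (28/ε) N^{ε/4}`, and the product has `≤ 4` factors. -/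
theorem fewPrimeBoundWithoutSemistable_of_szpiro (hS : SzpiroConjecture) {ε : ℝ} (hε : 0 < ε) :
    FewPrimeBoundWithoutSemistable ε := by
  obtain ⟨C₁, hC₁⟩ := hS 1 one_pos
  set C := max C₁ 1 with hCdef
  have hC1 : 1 ≤ C := le_max_right _ _
  have hC0 : 0 < C := one_pos.trans_le hC1
  set δ := ε / 4 with hδ
  have hδ0 : 0 < δ := by positivity
  have hlog2 : 0 < Real.log 2 := Real.log_pos one_lt_two
  set K : ℝ := 1 + Real.log C / Real.log 2 + 7 / (δ * Real.log 2) with hK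
  have ha : 0 ≤ Real.log C / Real.log 2 := div_nonneg (Real.log_nonneg hC1) hlog2.le
  have hb : 0 ≤ 7 / (δ * Real.log 2) := by positivity
  have hK1 : 1 ≤ K := by linarith
  refine ⟨K ^ 4, fun W _ hcard => ?_⟩
  set N := W.conductorNorm ℤ with hN
  set Δ := W.minimalDiscriminantNorm ℤ with hΔ
  have hNpos : 0 < N := conductorNorm_pos_holds W
  have hN1 : (1 : ℝ) ≤ N := by exact_mod_cast hNpos
  have hN0 : (0 : ℝ) < N := by linarith
  have hSz : (Δ : ℝ) ≤ C * (N : ℝ) ^ (7 : ℝ) := by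
    calc (Δ : ℝ) ≤ C₁ * (N : ℝ) ^ ((6 : ℝ) + 1) := hC₁ W
      _ = C₁ * (N : ℝ) ^ (7 : ℝ) := by norm_num
      _ ≤ C * (N : ℝ) ^ (7 : ℝ) := mul_le_mul_of_nonneg_right (le_max_left _ _) (by positivity)
  have hNδ : 1 ≤ (N : ℝ) ^ δ := Real.one_le_rpow hN1 hδ0.le
  -- each factor of the product is `≤ K N^δ`
  have hfac : ∀ p ∈ N.primeFactors, ((Δ.factorization p : ℕ) : ℝ) ≤ K * (N : ℝ) ^ δ := by
    intro p hp
    have hp2 : 2 ≤ p := (Nat.prime_of_mem_primeFactors hp).two_le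
    by_cases hΔ0 : Δ = 0
    · rw [hΔ0, Nat.factorization_zero, Finsupp.zero_apply, Nat.cast_zero]; positivity
    have h1 : (2 : ℝ) ^ (Δ.factorization p) ≤ Δ := by
      exact_mod_cast le_trans (Nat.pow_le_pow_left hp2 _) (Nat.ordProj_le p hΔ0)
    have h2 : (Δ.factorization p : ℝ) * Real.log 2 ≤ Real.log C + 7 * Real.log N := by
      have := Real.log_le_log (by positivity) (h1.trans hSz)
      rw [Real.log_pow, Real.log_mul hC0.ne' (by positivity), Real.log_rpow hN0] at this
      linarith
    have h3 : Real.log N ≤ (N : ℝ) ^ δ / δ := Real.log_le_rpow_div hN0.le hδ0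
    have h4 : (Δ.factorization p : ℝ) ≤ (Real.log C + 7 * ((N : ℝ) ^ δ / δ)) / Real.log 2 := by
      rw [le_div_iff₀ hlog2]; linarith
    calc (Δ.factorization p : ℝ) ≤ (Real.log C + 7 * ((N : ℝ) ^ δ / δ)) / Real.log 2 := h4
      _ = Real.log C / Real.log 2 + 7 / (δ * Real.log 2) * (N : ℝ) ^ δ := by
          field_simp
      _ ≤ Real.log C / Real.log 2 * (N : ℝ) ^ δ + 7 / (δ * Real.log 2) * (N : ℝ) ^ δ
            + 1 * (N : ℝ) ^ δ := by
          nlinarith [le_mul_of_one_le_right ha hNδ]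
      _ = K * (N : ℝ) ^ δ := by rw [hK]; ring
  -- the product has at most four factors
  set S := N.primeFactors.filter (fun p => ¬ p ^ 2 ∣ N) with hS
  have hScard : S.card ≤ 4 := by
    have hsub : S ⊆ insert 2 (N.primeFactors.filter (fun p => p ≠ 2 ∧ ¬ p ^ 2 ∣ N)) := by
      intro p hp
      rw [Finset.mem_insert, Finset.mem_filter]
      rw [Finset.mem_filter] at hp
      by_cases h2 : p = 2
      · exact Or.inl h2
      · exact Or.inr ⟨hp.1, h2, hp.2⟩
    calc S.card ≤ _ := Finset.card_le_card hsub
      _ ≤ (N.primeFactors.filter (fun p => p ≠ 2 ∧ ¬ p ^ 2 ∣ N)).card + 1 :=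
          Finset.card_insert_le _ _
      _ ≤ 4 := by omega
  have hT : (multiplicativeValuationProduct W : ℝ) = ∏ p ∈ S, ((Δ.factorization p : ℕ) : ℝ) := by
    rw [multiplicativeValuationProduct_def, Nat.cast_prod]
  have hKN : 1 ≤ K * (N : ℝ) ^ δ := one_le_mul_of_one_le_of_one_le hK1 hNδ
  rw [hT]
  calc ∏ p ∈ S, ((Δ.factorization p : ℕ) : ℝ) ≤ ∏ _p ∈ S, K * (N : ℝ) ^ δ :=
        Finset.prod_le_prod (fun _ _ => Nat.cast_nonneg _)
          (fun p hp => hfac p (Finset.mem_filter.mp hp).1)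
    _ = (K * (N : ℝ) ^ δ) ^ S.card := Finset.prod_const _
    _ ≤ (K * (N : ℝ) ^ δ) ^ 4 := pow_le_pow_right₀ hKN hScard
    _ = K ^ 4 * (N : ℝ) ^ ε := by
        rw [mul_pow, ← Real.rpow_natCast ((N : ℝ) ^ δ) 4, ← Real.rpow_mul hN0.le, hδ]
        norm_num

/-! ### Szpiro ⟹ the union (no prime count, no semistability): H_card is not load-bearing -/

/-- `x ≤ p^{δx} / (δ log p)` for `x ≥ 0`, `p ≥ 2`, `δ > 0` (from `u ≤ eᵘ` with `u = δ x log p`). -/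
private theorem le_rpow_div {x p δ : ℝ} (hp : 2 ≤ p) (hδ : 0 < δ) :
    x ≤ p ^ (δ * x) / (δ * Real.log p) := by
  have hp0 : 0 < p := by linarith
  have hlogp : 0 < Real.log p := Real.log_pos (by linarith)
  have hden : 0 < δ * Real.log p := mul_pos hδ hlogp
  rw [le_div_iff₀ hden]
  have h1 : δ * x * Real.log p ≤ Real.exp (δ * x * Real.log p) := by
    linarith [Real.add_one_le_exp (δ * x * Real.log p)]
  calc x * (δ * Real.log p) = δ * x * Real.log p := by ring
    _ ≤ Real.exp (δ * x * Real.log p) := h1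
    _ = p ^ (δ * x) := by rw [Real.rpow_def_of_pos hp0]; ring_nf

/-- **Szpiro ⟹ `∏_{p ∥ N} v_p(Δ_min) ≤ K_ε N^ε` for EVERY elliptic curve over `ℚ`** (no bound on the
number of primes, no semistability): the de Weger/Hindry-type bookkeeping. With `δ = ε/7` and
`x_p = v_p(Δ_min)`: `x_p ≤ p^{δ x_p}/(δ log p)`, so
`T ≤ (∏_{p ∥ N} p^{x_p})^δ · ∏_{p ∥ N} (δ log p)⁻¹ ≤ |Δ_min|^δ · B^{M+1}` where `B = max 1 (δ log 2)⁻¹`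
and only the `≤ M + 1` primes `p ≤ M = ⌈e^{1/δ}⌉` have a factor `> 1`; finally `|Δ_min| ≤ C N⁷`.
Hence, under Szpiro, BOTH cruxes r2/r4 and their union hold: neither H_card nor H_sf is
load-bearing at truth level, and refuting any of them refutes Szpiro. -/
theorem valuationProduct_le_of_szpiro (hS : SzpiroConjecture) {ε : ℝ} (hε : 0 < ε) :
    ∃ K : ℝ, ∀ (W : WeierstrassCurve ℚ) [W.IsElliptic],
      (multiplicativeValuationProduct W : ℝ) ≤ K * (W.conductorNorm ℤ : ℝ) ^ ε := by
  obtain ⟨C₁, hC₁⟩ := hS 1 one_pos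
  set C := max C₁ 1 with hCdef
  have hC1 : 1 ≤ C := le_max_right _ _
  have hC0 : 0 < C := one_pos.trans_le hC1
  set δ := ε / 7 with hδ
  have hδ0 : 0 < δ := by positivity
  have hlog2 : 0 < Real.log 2 := Real.log_pos one_lt_two
  set B : ℝ := max 1 (δ * Real.log 2)⁻¹ with hB
  have hB1 : 1 ≤ B := le_max_left _ _
  set M : ℕ := ⌈Real.exp (1 / δ)⌉₊ with hM
  set K : ℝ := C ^ δ * B ^ (M + 1) with hK
  have hK1 : 1 ≤ K := one_le_mul_of_one_le_of_one_le (Real.one_le_rpow hC1 hδ0.le)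
    (one_le_pow₀ hB1)
  refine ⟨K, fun W _ => ?_⟩
  set N := W.conductorNorm ℤ with hN
  set Δ := W.minimalDiscriminantNorm ℤ with hΔ
  have hNpos : 0 < N := conductorNorm_pos_holds W
  have hN1 : (1 : ℝ) ≤ N := by exact_mod_cast hNpos
  have hN0 : (0 : ℝ) < N := by linarith
  have hNε : 1 ≤ (N : ℝ) ^ ε := Real.one_le_rpow hN1 hε.le
  set S := N.primeFactors.filter (fun p => ¬ p ^ 2 ∣ N) with hS
  set x : ℕ → ℕ := fun p => Δ.factorization p with hx
  have hT : (multiplicativeValuationProduct W : ℝ) = ∏ p ∈ S, ((x p : ℕ) : ℝ) := by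
    rw [multiplicativeValuationProduct_def, Nat.cast_prod]
  rw [hT]
  -- degenerate case `Δ = 0` (junk value; all `x_p = 0`)
  by_cases hΔ0 : Δ = 0
  · have : ∏ p ∈ S, ((x p : ℕ) : ℝ) ≤ 1 := by
      refine Finset.prod_le_one (fun _ _ => Nat.cast_nonneg _) fun p _ => ?_
      simp [hx, hΔ0]
    calc ∏ p ∈ S, ((x p : ℕ) : ℝ) ≤ 1 := this
      _ ≤ K * (N : ℝ) ^ ε := one_le_mul_of_one_le_of_one_le hK1 hNε
  have hSprime : ∀ p ∈ S, p.Prime := fun p hp => Nat.prime_of_mem_primeFactors (Finset.mem_filter.mp hp).1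
  -- Step 1–2: `T ≤ ∏ p^{δ x_p} · ∏ (δ log p)⁻¹`
  have hstep : ∏ p ∈ S, ((x p : ℕ) : ℝ) ≤
      (∏ p ∈ S, ((p : ℝ) ^ (x p : ℕ)) ^ δ) * ∏ p ∈ S, (δ * Real.log p)⁻¹ := by
    rw [← Finset.prod_mul_distrib]
    refine Finset.prod_le_prod (fun _ _ => Nat.cast_nonneg _) fun p hp => ?_
    have hp2 : (2 : ℝ) ≤ p := by exact_mod_cast (hSprime p hp).two_le
    have h := le_rpow_div (x := (x p : ℝ)) hp2 hδ0
    rw [div_eq_mul_inv] at h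
    have hpow : ((p : ℝ) ^ (x p : ℕ)) ^ δ = (p : ℝ) ^ (δ * (x p : ℝ)) := by
      rw [← Real.rpow_natCast, ← Real.rpow_mul (by linarith), mul_comm]
    rwa [hpow]
  -- Step 3–4: `∏ p^{x_p} ≤ Δ ≤ C N^7`
  have hD : (∏ p ∈ S, ((p : ℝ) ^ (x p : ℕ))) ≤ C * (N : ℝ) ^ (7 : ℝ) := by
    have hdvd : ∏ p ∈ S, p ^ x p ∣ Δ := by
      have hD0 : ∏ p ∈ S, p ^ x p ≠ 0 :=
        Finset.prod_ne_zero_iff.mpr fun p hp => pow_ne_zero _ (hSprime p hp).ne_zero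
      rw [← Nat.factorization_le_iff_dvd hD0 hΔ0,
        Nat.factorization_prod fun p hp => pow_ne_zero _ (hSprime p hp).ne_zero]
      intro q
      rw [Finsupp.finsetSum_apply,
        Finset.sum_congr rfl fun p hp => by rw [(hSprime p hp).factorization_pow]]
      simp only [Finsupp.single_apply]
      rw [Finset.sum_ite_eq']
      split_ifs <;> simp [hx]
    have h1 : ((∏ p ∈ S, p ^ x p : ℕ) : ℝ) ≤ Δ := by
      exact_mod_cast Nat.le_of_dvd (Nat.pos_of_ne_zero hΔ0) hdvd
    calc (∏ p ∈ S, ((p : ℝ) ^ (x p : ℕ))) = ((∏ p ∈ S, p ^ x p : ℕ) : ℝ) := by push_cast; rfl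
      _ ≤ Δ := h1
      _ ≤ C₁ * (N : ℝ) ^ ((6 : ℝ) + 1) := hC₁ W
      _ = C₁ * (N : ℝ) ^ (7 : ℝ) := by norm_num
      _ ≤ C * (N : ℝ) ^ (7 : ℝ) := mul_le_mul_of_nonneg_right (le_max_left _ _) (by positivity)
  have hDnn : 0 ≤ ∏ p ∈ S, ((p : ℝ) ^ (x p : ℕ)) :=
    Finset.prod_nonneg fun _ _ => by positivity
  -- Step 5: `∏ (δ log p)⁻¹ ≤ B^{M+1}`
  have hlogfac : ∏ p ∈ S, (δ * Real.log p)⁻¹ ≤ B ^ (M + 1) := by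
    rw [← Finset.prod_filter_mul_prod_filter_not S (fun p => p ≤ M)]
    have hsmall : ∏ p ∈ S.filter (fun p => p ≤ M), (δ * Real.log p)⁻¹ ≤ B ^ (M + 1) := by
      have hcard : (S.filter (fun p => p ≤ M)).card ≤ M + 1 := by
        calc (S.filter (fun p => p ≤ M)).card ≤ (Finset.range (M + 1)).card :=
              Finset.card_le_card fun p hp => by
                rw [Finset.mem_range]; exact Nat.lt_succ_of_le (Finset.mem_filter.mp hp).2
          _ = M + 1 := Finset.card_range _
      calc ∏ p ∈ S.filter (fun p => p ≤ M), (δ * Real.log p)⁻¹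
          ≤ ∏ _p ∈ S.filter (fun p => p ≤ M), B := by
            refine Finset.prod_le_prod (fun p hp => ?_) (fun p hp => ?_)
            · have := (hSprime p (Finset.mem_filter.mp hp).1).two_le
              have : (2 : ℝ) ≤ p := by exact_mod_cast this
              have : 0 < Real.log p := Real.log_pos (by linarith)
              positivity
            · have h2 := (hSprime p (Finset.mem_filter.mp hp).1).two_le
              have h2' : (2 : ℝ) ≤ p := by exact_mod_cast h2
              have hlp : Real.log 2 ≤ Real.log p := Real.log_le_log two_pos h2'
              calc (δ * Real.log p)⁻¹ ≤ (δ * Real.log 2)⁻¹ := by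
                    apply inv_anti₀ (mul_pos hδ0 hlog2)
                    exact mul_le_mul_of_nonneg_left hlp hδ0.le
                _ ≤ B := le_max_right _ _
        _ = B ^ (S.filter (fun p => p ≤ M)).card := Finset.prod_const _
        _ ≤ B ^ (M + 1) := pow_le_pow_right₀ hB1 hcard
    have hlarge : ∏ p ∈ S.filter (fun p => ¬ p ≤ M), (δ * Real.log p)⁻¹ ≤ 1 := by
      refine Finset.prod_le_one (fun p hp => ?_) (fun p hp => ?_)
      · have := (hSprime p (Finset.mem_filter.mp hp).1).two_le
        have : (2 : ℝ) ≤ p := by exact_mod_cast this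
        have : 0 < Real.log p := Real.log_pos (by linarith)
        positivity
      · have hpM : M < p := not_le.mp (Finset.mem_filter.mp hp).2
        have hp0 : (0 : ℝ) < p := by exact_mod_cast lt_of_le_of_lt (Nat.zero_le _) hpM
        have hexp : Real.exp (1 / δ) < p := by
          calc Real.exp (1 / δ) ≤ M := Nat.le_ceil _
            _ < p := by exact_mod_cast hpM
        have hlog : 1 / δ < Real.log p := (Real.lt_log_iff_exp_lt hp0).mpr hexp
        have h1 : 1 ≤ δ * Real.log p := by
          rw [div_lt_iff₀ hδ0] at hlog; linarith
        exact inv_le_one_of_one_le₀ h1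
    have hsmall0 : 0 ≤ ∏ p ∈ S.filter (fun p => p ≤ M), (δ * Real.log p)⁻¹ :=
      Finset.prod_nonneg fun p hp => by
        have := (hSprime p (Finset.mem_filter.mp hp).1).two_le
        have : (2 : ℝ) ≤ p := by exact_mod_cast this
        have : 0 < Real.log p := Real.log_pos (by linarith)
        positivity
    calc _ ≤ B ^ (M + 1) * 1 := mul_le_mul hsmall hlarge
          (Finset.prod_nonneg fun p hp => by
            have := (hSprime p (Finset.mem_filter.mp hp).1).two_le
            have : (2 : ℝ) ≤ p := by exact_mod_cast this
            have : 0 < Real.log p := Real.log_pos (by linarith)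
            positivity) (by positivity)
      _ = B ^ (M + 1) := mul_one _
  -- Step 6: assemble
  calc ∏ p ∈ S, ((x p : ℕ) : ℝ)
      ≤ (∏ p ∈ S, ((p : ℝ) ^ (x p : ℕ)) ^ δ) * ∏ p ∈ S, (δ * Real.log p)⁻¹ := hstep
    _ = (∏ p ∈ S, ((p : ℝ) ^ (x p : ℕ))) ^ δ * ∏ p ∈ S, (δ * Real.log p)⁻¹ := by
        rw [Real.finsetProd_rpow _ _ (fun _ _ => by positivity)]
    _ ≤ (C * (N : ℝ) ^ (7 : ℝ)) ^ δ * B ^ (M + 1) := by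
        refine mul_le_mul (Real.rpow_le_rpow hDnn hD hδ0.le) hlogfac
          (Finset.prod_nonneg fun p hp => ?_) (by positivity)
        have := (hSprime p hp).two_le
        have : (2 : ℝ) ≤ p := by exact_mod_cast this
        have : 0 < Real.log p := Real.log_pos (by linarith)
        positivity
    _ = K * (N : ℝ) ^ ε := by
        rw [Real.mul_rpow hC0.le (by positivity), ← Real.rpow_mul hN0.le, hK, hδ]
        ring_nf

/-- **Szpiro ⟹ the sibling crux `ManyPrimeValuationProduct`** (stmt-ABC-1561), from
`valuationProduct_le_of_szpiro`. -/
theorem manyPrimeValuationProduct_of_szpiro (hS : SzpiroConjecture) : ManyPrimeValuationProduct := by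
  intro ε hε
  obtain ⟨K, hK⟩ := valuationProduct_le_of_szpiro hS hε
  exact ⟨K, fun W _ _ _ => hK W⟩

/-- **Szpiro ⟹ the union** (`ValuationProductBound ε` for every `ε > 0`; Pasten's Conjecture 1.14
shape for `∏_{p ∥ N} v_p(Δ_min)`, ALL elliptic curves). -/
theorem valuationProductBound_of_szpiro (hS : SzpiroConjecture) {ε : ℝ} (hε : 0 < ε) :
    ValuationProductBound ε := by
  obtain ⟨K, hK⟩ := valuationProduct_le_of_szpiro hS hε
  exact ⟨K, fun W _ _ => hK W⟩

/-- **Slack in the exponent.** Under Szpiro the few-prime truth is POLYLOGARITHMIC: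
`T ≤ ((log C + 7 log N)/log 2)^4` whenever there are `≤ 3` odd multiplicative primes (no H_sf) —
so `N^ε` in the crux is a convenience, not the conjectural order (`(log N)^3` by Lagrange, `≥ log N`
by the Mersenne–Frey family). -/
theorem fewPrime_polylog_of_szpiro (hS : SzpiroConjecture) :
    ∃ A : ℝ, ∀ (W : WeierstrassCurve ℚ) [W.IsElliptic],
      ((W.conductorNorm ℤ).primeFactors.filter
          (fun p => p ≠ 2 ∧ ¬ p ^ 2 ∣ W.conductorNorm ℤ)).card ≤ 3 →
      (multiplicativeValuationProduct W : ℝ) ≤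
        (A + 7 / Real.log 2 * Real.log (W.conductorNorm ℤ)) ^ 4 := by
  obtain ⟨C₁, hC₁⟩ := hS 1 one_pos
  set C := max C₁ 1 with hCdef
  have hC1 : 1 ≤ C := le_max_right _ _
  have hC0 : 0 < C := one_pos.trans_le hC1
  have hlog2 : 0 < Real.log 2 := Real.log_pos one_lt_two
  refine ⟨1 + Real.log C / Real.log 2, fun W _ hcard => ?_⟩
  set N := W.conductorNorm ℤ with hN
  set Δ := W.minimalDiscriminantNorm ℤ with hΔ
  have hNpos : 0 < N := conductorNorm_pos_holds W
  have hN1 : (1 : ℝ) ≤ N := by exact_mod_cast hNpos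
  have hN0 : (0 : ℝ) < N := by linarith
  have hSz : (Δ : ℝ) ≤ C * (N : ℝ) ^ (7 : ℝ) := by
    calc (Δ : ℝ) ≤ C₁ * (N : ℝ) ^ ((6 : ℝ) + 1) := hC₁ W
      _ = C₁ * (N : ℝ) ^ (7 : ℝ) := by norm_num
      _ ≤ C * (N : ℝ) ^ (7 : ℝ) := mul_le_mul_of_nonneg_right (le_max_left _ _) (by positivity)
  set X : ℝ := 1 + Real.log C / Real.log 2 + 7 / Real.log 2 * Real.log N with hX
  have ha : 0 ≤ Real.log C / Real.log 2 := div_nonneg (Real.log_nonneg hC1) hlog2.le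
  have hb : 0 ≤ 7 / Real.log 2 * Real.log N := by
    have := Real.log_nonneg hN1; positivity
  have hX1 : 1 ≤ X := by linarith
  have hfac : ∀ p ∈ N.primeFactors, ((Δ.factorization p : ℕ) : ℝ) ≤ X := by
    intro p hp
    have hp2 : 2 ≤ p := (Nat.prime_of_mem_primeFactors hp).two_le
    by_cases hΔ0 : Δ = 0
    · rw [hΔ0, Nat.factorization_zero, Finsupp.zero_apply, Nat.cast_zero]; linarith
    have h1 : (2 : ℝ) ^ (Δ.factorization p) ≤ Δ := by
      exact_mod_cast le_trans (Nat.pow_le_pow_left hp2 _) (Nat.ordProj_le p hΔ0)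
    have h2 : (Δ.factorization p : ℝ) * Real.log 2 ≤ Real.log C + 7 * Real.log N := by
      have := Real.log_le_log (by positivity) (h1.trans hSz)
      rw [Real.log_pow, Real.log_mul hC0.ne' (by positivity), Real.log_rpow hN0] at this
      linarith
    have h4 : (Δ.factorization p : ℝ) ≤ (Real.log C + 7 * Real.log N) / Real.log 2 := by
      rw [le_div_iff₀ hlog2]; linarith
    calc (Δ.factorization p : ℝ) ≤ (Real.log C + 7 * Real.log N) / Real.log 2 := h4
      _ = Real.log C / Real.log 2 + 7 / Real.log 2 * Real.log N := by field_simp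
      _ ≤ X := by rw [hX]; linarith
  set S := N.primeFactors.filter (fun p => ¬ p ^ 2 ∣ N) with hS
  have hScard : S.card ≤ 4 := by
    have hsub : S ⊆ insert 2 (N.primeFactors.filter (fun p => p ≠ 2 ∧ ¬ p ^ 2 ∣ N)) := by
      intro p hp
      rw [Finset.mem_insert, Finset.mem_filter]
      rw [Finset.mem_filter] at hp
      by_cases h2 : p = 2
      · exact Or.inl h2
      · exact Or.inr ⟨hp.1, h2, hp.2⟩
    calc S.card ≤ _ := Finset.card_le_card hsub
      _ ≤ (N.primeFactors.filter (fun p => p ≠ 2 ∧ ¬ p ^ 2 ∣ N)).card + 1 :=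
          Finset.card_insert_le _ _
      _ ≤ 4 := by omega
  have hT : (multiplicativeValuationProduct W : ℝ) = ∏ p ∈ S, ((Δ.factorization p : ℕ) : ℝ) := by
    rw [multiplicativeValuationProduct_def, Nat.cast_prod]
  rw [hT]
  calc ∏ p ∈ S, ((Δ.factorization p : ℕ) : ℝ) ≤ ∏ _p ∈ S, X :=
        Finset.prod_le_prod (fun _ _ => Nat.cast_nonneg _)
          (fun p hp => hfac p (Finset.mem_filter.mp hp).1)
    _ = X ^ S.card := Finset.prod_const _
    _ ≤ X ^ 4 := pow_le_pow_right₀ hX1 hScard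

/-- **Szpiro ⟹ FewPrimeValuationProduct** (so a refutation of the crux refutes Szpiro; none is
expected). The crux sits between "sub-exponential Szpiro on the few-prime class" and Szpiro. -/
theorem fewPrimeValuationProduct_of_szpiro (hS : SzpiroConjecture) : FewPrimeValuationProduct :=
  fun _ hε => (fewPrimeBoundWithoutSemistable_of_szpiro hS hε).toFewPrimeBound


/-! ## §5 Cycle 2 (cdisprove g2, 2026-08-16): the Chen family packaged; quantifier swap; growth of
`C(ε)`; tightness in `log N`; no prime-only valuation bound; tightness of the idea stubs
(`PowerOfTwoFacePolylog` needs `A ≥ 1`, `FreyFewPrimeValuationProduct` needs its `ε`); the hard-core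
`ε`-drop modulo a prime pattern

Everything below is ALSO filed for the tree as negative support (`--supports stmt-ABC-1563`):
`Theorems/FewPrimeValuationProduct/Negative/ChenFamily.lean` (curve statements, over the Literature
names of the family) and `Theorems/FewPrimeValuationProduct/Negative/FaceTightness.lean` (triple
statements); the in-file copies keep this work file self-contained. -/

section CycleTwo

open scoped ArithmeticFunction.Omega

/-! ### The crux with constant and exponent fixed -/

/-- The crux inequality with BOTH the constant `C` and the exponent `ε` fixed; the crux is
`∀ ε > 0, ∃ C, FewPrimeBoundWith C ε` (`fewPrimeValuationProduct_iff_with`). -/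
def FewPrimeBoundWith (C ε : ℝ) : Prop :=
  ∀ (W : WeierstrassCurve ℚ) [W.IsElliptic],
    (∀ p : ℕ, p.Prime → p ≠ 2 → ¬ p ^ 2 ∣ W.conductorNorm ℤ) →
    ((W.conductorNorm ℤ).primeFactors.filter
        (fun p => p ≠ 2 ∧ ¬ p ^ 2 ∣ W.conductorNorm ℤ)).card ≤ 3 →
    (multiplicativeValuationProduct W : ℝ) ≤ C * (W.conductorNorm ℤ : ℝ) ^ ε

/-- The crux is `∀ ε > 0, ∃ C, FewPrimeBoundWith C ε` (definitional). -/
theorem fewPrimeValuationProduct_iff_with :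
    FewPrimeValuationProduct ↔ ∀ ε : ℝ, 0 < ε → ∃ C : ℝ, FewPrimeBoundWith C ε := Iff.rfl

/-! ### The Chen family, packaged -/

/-- Supplement to `freyCurve_two_pow_spec` for the Frey curve of `a + 2ⁿ` (`a ≡ -1 (mod 4)`, `n ≥ 5`):
`2 ∥ N`, `v₂(Δ_min) = 2n - 8` exactly, and `N ≤ |a| · 2ⁿ · |a + 2ⁿ|`. -/
theorem freyCurve_two_pow_spec₂ {a : ℤ} {n : ℕ} (ha : a ≡ -1 [ZMOD 4]) (hn : 5 ≤ n)
    (hc : a + 2 ^ n ≠ 0) :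
    2 ∣ (freyCurve a (2 ^ n)).conductorNorm ℤ ∧ ¬ 2 ^ 2 ∣ (freyCurve a (2 ^ n)).conductorNorm ℤ ∧
    ((freyCurve a (2 ^ n)).minimalDiscriminantNorm ℤ).factorization 2 = 2 * n - 8 ∧
    (freyCurve a (2 ^ n)).conductorNorm ℤ ≤ a.natAbs * 2 ^ n * (a + 2 ^ n).natAbs := by
  have ha0 : a ≠ 0 := by
    rintro rfl
    exact absurd (Int.ModEq.dvd ha) (by decide)
  have hodd : ¬ (2 : ℤ) ∣ a := by
    intro h2
    have h4 : (4 : ℤ) ∣ -1 - a := Int.ModEq.dvd ha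
    omega
  have hab : IsCoprime a (2 ^ n) := isCoprime_two_pow_of_mod ha n
  have h0 : a * 2 ^ n * (a + 2 ^ n) ≠ 0 := mul_ne_zero (mul_ne_zero ha0 (by positivity)) hc
  have hb : (32 : ℤ) ∣ 2 ^ n := by
    rw [show (32 : ℤ) = 2 ^ 5 by norm_num]; exact pow_dvd_pow 2 hn
  set M := (a * 2 ^ n * (a + 2 ^ n)).natAbs with hM
  have hM0 : M ≠ 0 := Int.natAbs_ne_zero.mpr h0
  have hMeq : M = a.natAbs * 2 ^ n * (a + 2 ^ n).natAbs := by
    rw [hM, Int.natAbs_mul, Int.natAbs_mul, Int.natAbs_pow]; rfl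
  have hodd' : ¬ 2 ∣ a.natAbs := fun h => hodd (by exact_mod_cast Int.natCast_dvd.mpr h)
  have hcodd : ¬ (2 : ℤ) ∣ a + 2 ^ n := by
    intro h
    exact hodd ((Int.dvd_add_left (dvd_pow_self 2 (by omega))).mp h)
  have hcodd' : ¬ 2 ∣ (a + 2 ^ n).natAbs := fun h =>
    hcodd (by exact_mod_cast Int.natCast_dvd.mpr h)
  have hM2 : M.factorization 2 = n := by
    rw [hMeq, Nat.factorization_mul (mul_ne_zero (Int.natAbs_ne_zero.mpr ha0) (by positivity))
      (Int.natAbs_ne_zero.mpr hc), Nat.factorization_mul (Int.natAbs_ne_zero.mpr ha0) (by positivity)]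
    simp [Nat.factorization_eq_zero_of_not_dvd hodd', Nat.factorization_eq_zero_of_not_dvd hcodd',
      Nat.prime_two.factorization_self]
  have h2M : 2 ∈ M.primeFactors :=
    Nat.mem_primeFactors.mpr ⟨Nat.prime_two, by
      rw [hMeq]; exact dvd_mul_of_dvd_left (dvd_mul_of_dvd_right (dvd_pow_self 2 (by omega)) _) _,
      hM0⟩
  have hN : (freyCurve a (2 ^ n)).conductorNorm ℤ = radical M :=
    conductorNorm_freyCurve_serre hab h0 ha hb
  have hsq : Squarefree ((freyCurve a (2 ^ n)).conductorNorm ℤ) := by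
    rw [hN]; exact squarefree_radical
  refine ⟨?_, fun h => Nat.squarefree_iff_prime_squarefree.mp hsq 2 Nat.prime_two
    (by simpa [sq] using h), ?_, ?_⟩
  · rw [hN]
    have : 2 ∈ (radical M).primeFactors := by rw [Nat.primeFactors_radical]; exact h2M
    exact Nat.dvd_of_mem_primeFactors this
  · rw [factorization_minimalDiscriminantNorm_freyCurve_serre hab h0 ha hb 2, ← hM, hM2, if_pos rfl]
  · rw [hN, ← hMeq]
    exact Nat.radical_le_self_iff.mpr hM0

/-- **The Chen family of the few-prime class.** There is `n₀` such that for every `n ≥ n₀` some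
elliptic curve over `ℚ` is semistable away from `2` (in fact semistable), has at most `3` odd
multiplicative primes, multiplicative reduction at `2` (`2 ∥ N`) with `v₂(Δ_min) ≥ 2n - 10`, hence
`T ≥ 2n - 10`, and conductor `N < 2^{3n}`. Construction: Chen (`chen_goldbach_holds`) splits
`2ⁿ = ℓ + m`, `ℓ` prime, `Ω(m) ≤ 2`; `ℓ = 2` gives the Mersenne–Frey curve `y² = x(x+1)(x+2ⁿ⁻¹)`,
`ℓ ≡ 1 (4)` the Frey curve `freyCurve (-ℓ) (2ⁿ)`, `ℓ ≡ 3 (4)` the Frey curve `freyCurve (-m) (2ⁿ)`. -/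
theorem exists_chen_member : ∃ n₀ : ℕ, ∀ n : ℕ, n₀ ≤ n → ∃ W : WeierstrassCurve ℚ, W.IsElliptic ∧
    (∀ p : ℕ, p.Prime → p ≠ 2 → ¬ p ^ 2 ∣ W.conductorNorm ℤ) ∧
    ((W.conductorNorm ℤ).primeFactors.filter
        (fun p => p ≠ 2 ∧ ¬ p ^ 2 ∣ W.conductorNorm ℤ)).card ≤ 3 ∧
    2 ∣ W.conductorNorm ℤ ∧ ¬ 2 ^ 2 ∣ W.conductorNorm ℤ ∧
    2 * n - 10 ≤ (W.minimalDiscriminantNorm ℤ).factorization 2 ∧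
    2 * n - 10 ≤ multiplicativeValuationProduct W ∧
    W.conductorNorm ℤ < 2 ^ (3 * n) := by
  obtain ⟨N₀, hN₀⟩ := Literature.NumberTheory.Sieve.chen_goldbach_holds
  refine ⟨N₀ + 6, fun n hn => ?_⟩
  have hnN : N₀ ≤ 2 ^ n := le_trans (by omega) (Nat.lt_two_pow_self).le
  have heven : Even (2 ^ n) := (Nat.even_pow' (by omega)).mpr even_two
  obtain ⟨ℓ, m, hℓ, ⟨hm0, hΩ⟩, hsum⟩ := hN₀ (2 ^ n) hnN heven
  have hωm : m.primeFactors.card ≤ 2 := (card_primeFactors_le_cardFactors m).trans hΩ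
  have h3n : 2 ^ n * 2 ^ n * 2 ^ n = 2 ^ (3 * n) := by
    rw [show 3 * n = n + n + n by ring, pow_add, pow_add]
  have hmpos : 0 < m := Nat.pos_of_ne_zero hm0
  have hℓlt : ℓ < 2 ^ n := by have := hℓ.two_le; omega
  have hmlt : m < 2 ^ n := by have := hℓ.two_le; omega
  by_cases hℓ2 : ℓ = 2
  · -- `m = 2ⁿ - 2 = 2 (2ⁿ⁻¹ - 1)`: the Mersenne–Frey curve of `n - 1`
    subst hℓ2
    have hdvd : mersenne (n - 1) ∣ m := by
      refine ⟨2, ?_⟩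
      have h2n : 2 ^ n = 2 * 2 ^ (n - 1) := by
        rw [← pow_succ', Nat.sub_add_cancel (by omega : 1 ≤ n)]
      simp only [mersenne]
      have : 1 ≤ 2 ^ (n - 1) := Nat.one_le_two_pow
      omega
    have hω : (mersenne (n - 1)).primeFactors.card ≤ 3 :=
      (Finset.card_le_card (Nat.primeFactors_mono hdvd hm0)).trans (hωm.trans (by norm_num))
    have h5 : 5 ≤ n - 1 := by omega
    refine ⟨mersenneFrey (n - 1), isElliptic_mersenneFrey (by omega),
      mersenneFrey_hyp₁ h5,
      by rw [oddMultiplicativePrimes_mersenneFrey h5]; exact hω, ?_, ?_, ?_, ?_, ?_⟩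
    · rw [conductorNorm_mersenneFrey_eq h5]; exact dvd_mul_right 2 _
    · intro h
      exact Nat.squarefree_iff_prime_squarefree.mp (squarefree_conductorNorm_mersenneFrey h5) 2
        Nat.prime_two (by simpa [sq] using h)
    · rw [factorization_two_minimalDiscriminantNorm_mersenneFrey h5]; omega
    · have := le_multiplicativeValuationProduct_mersenneFrey h5; omega
    · calc _ < 2 ^ (n - 1 + 1) := conductorNorm_mersenneFrey_lt h5
        _ ≤ 2 ^ (3 * n) := Nat.pow_le_pow_right two_pos (by omega)
  · -- `ℓ` odd
    have hℓodd : ℓ % 2 = 1 := by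
      rcases Nat.even_or_odd ℓ with h | h
      · exact absurd (hℓ.even_iff.mp h) hℓ2
      · exact Nat.odd_iff.mp h
    have hωℓ : ℓ.primeFactors.card = 1 := by rw [hℓ.primeFactors, Finset.card_singleton]
    -- common packaging of the two Frey sub-cases
    have pack : ∀ (a : ℤ), a ≡ -1 [ZMOD 4] → a + 2 ^ n ≠ 0 →
        a.natAbs.primeFactors.card + (a + 2 ^ n).natAbs.primeFactors.card ≤ 3 →
        a.natAbs * 2 ^ n * (a + 2 ^ n).natAbs < 2 ^ (3 * n) →
        ∃ W : WeierstrassCurve ℚ, W.IsElliptic ∧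
          (∀ p : ℕ, p.Prime → p ≠ 2 → ¬ p ^ 2 ∣ W.conductorNorm ℤ) ∧
          ((W.conductorNorm ℤ).primeFactors.filter
              (fun p => p ≠ 2 ∧ ¬ p ^ 2 ∣ W.conductorNorm ℤ)).card ≤ 3 ∧
          2 ∣ W.conductorNorm ℤ ∧ ¬ 2 ^ 2 ∣ W.conductorNorm ℤ ∧
          2 * n - 10 ≤ (W.minimalDiscriminantNorm ℤ).factorization 2 ∧
          2 * n - 10 ≤ multiplicativeValuationProduct W ∧
          W.conductorNorm ℤ < 2 ^ (3 * n) := by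
      intro a ha hc hω hlt
      obtain ⟨hE, h₁, hcard, hT⟩ := freyCurve_two_pow_spec (n := n) ha (by omega) hc
      obtain ⟨h2, h4, hv, hN⟩ := freyCurve_two_pow_spec₂ (n := n) ha (by omega) hc
      exact ⟨freyCurve a (2 ^ n), hE, h₁, hcard.trans hω, h2, h4, by rw [hv]; omega, by omega,
        lt_of_le_of_lt hN hlt⟩
    have hsize : ℓ * 2 ^ n * m < 2 ^ (3 * n) := by
      rw [← h3n]
      calc ℓ * 2 ^ n * m ≤ ℓ * 2 ^ n * 2 ^ n := Nat.mul_le_mul_left _ hmlt.le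
        _ < 2 ^ n * 2 ^ n * 2 ^ n :=
            mul_lt_mul_of_pos_right (mul_lt_mul_of_pos_right hℓlt (by positivity)) (by positivity)
    rcases Nat.odd_mod_four_iff.mp hℓodd with h1 | h3
    · -- `ℓ ≡ 1 (4)`: `a = -ℓ`, `a + 2ⁿ = m`
      have ha : (-(ℓ : ℤ)) ≡ -1 [ZMOD 4] := by
        have : (ℓ : ℤ) % 4 = 1 := by exact_mod_cast h1
        exact Int.ModEq.neg this
      have hc : -(ℓ : ℤ) + 2 ^ n = m := by
        have := congrArg (fun k : ℕ => (k : ℤ)) hsum; push_cast at this; linarith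
      have hc0 : -(ℓ : ℤ) + 2 ^ n ≠ 0 := by rw [hc]; exact_mod_cast hm0
      refine pack (-(ℓ : ℤ)) ha hc0 ?_ ?_
      · rw [hc, Int.natAbs_neg, Int.natAbs_natCast, Int.natAbs_natCast, hωℓ]; omega
      · rw [hc, Int.natAbs_neg, Int.natAbs_natCast, Int.natAbs_natCast]; exact hsize
    · -- `ℓ ≡ 3 (4)`: `m ≡ 1 (4)`, `a = -m`, `a + 2ⁿ = ℓ`
      have h4 : 4 ∣ 2 ^ n := (pow_dvd_pow 2 (by omega : 2 ≤ n))
      have hm1 : m % 4 = 1 := by omega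
      have ha : (-(m : ℤ)) ≡ -1 [ZMOD 4] := by
        have : (m : ℤ) % 4 = 1 := by exact_mod_cast hm1
        exact Int.ModEq.neg this
      have hc : -(m : ℤ) + 2 ^ n = ℓ := by
        have := congrArg (fun k : ℕ => (k : ℤ)) hsum; push_cast at this; linarith
      have hc0 : -(m : ℤ) + 2 ^ n ≠ 0 := by rw [hc]; exact_mod_cast hℓ.ne_zero
      refine pack (-(m : ℤ)) ha hc0 ?_ ?_
      · rw [hc, Int.natAbs_neg, Int.natAbs_natCast, Int.natAbs_natCast, hωℓ]; omega
      · rw [hc, Int.natAbs_neg, Int.natAbs_natCast, Int.natAbs_natCast]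
        calc m * 2 ^ n * ℓ = ℓ * 2 ^ n * m := by ring
          _ < 2 ^ (3 * n) := hsize

/-- Along the Chen family, `N^{1/(3n)} ≤ 2` and more generally `N^ε ≤ 2` once `3nε ≤ 1`. -/
private theorem rpow_conductor_le_two {N n : ℕ} (hN : N < 2 ^ (3 * n)) {ε : ℝ} (hε : 0 ≤ ε)
    (h : (3 * n : ℕ) * ε ≤ 1) : (N : ℝ) ^ ε ≤ 2 := by
  have hN0 : (0 : ℝ) ≤ N := Nat.cast_nonneg _
  have hNle : (N : ℝ) ≤ (2 : ℝ) ^ (3 * n : ℕ) := by exact_mod_cast hN.le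
  calc (N : ℝ) ^ ε ≤ ((2 : ℝ) ^ (3 * n : ℕ)) ^ ε := Real.rpow_le_rpow hN0 hNle hε
    _ = (2 : ℝ) ^ (((3 * n : ℕ) : ℝ) * ε) := by
        rw [← Real.rpow_natCast, ← Real.rpow_mul (by norm_num)]
    _ ≤ (2 : ℝ) ^ (1 : ℝ) := Real.rpow_le_rpow_of_exponent_le one_le_two h
    _ = 2 := Real.rpow_one 2

/-! ### (a) The quantifier swap is false; the constant grows at least like `1/ε` -/

/-- **No single constant serves every `ε`.** The strengthening `∃ C, ∀ ε > 0, ∀ E …, T(E) ≤ C N^ε`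
of the crux (quantifiers swapped) is FALSE: at `ε = 1/(3n)` a Chen member has `N^ε ≤ 2` but
`T ≥ 2n - 10`. So in any proof of the crux `C = C(ε) → ∞` as `ε → 0`. -/
theorem fewPrimeValuationProduct_false_uniform_constant :
    ¬ ∃ C : ℝ, ∀ ε : ℝ, 0 < ε → FewPrimeBoundWith C ε := by
  rintro ⟨C, hC⟩
  obtain ⟨n₀, hn₀⟩ := exists_chen_member
  set n : ℕ := n₀ + ⌈|C|⌉₊ + 6 with hn
  obtain ⟨W, hE, h₁, hcard, -, -, -, hT, hN⟩ := hn₀ n (by omega)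
  haveI := hE
  have hn0 : (0 : ℝ) < n := by exact_mod_cast (by omega : 0 < n)
  have hε : (0 : ℝ) < 1 / (3 * (n : ℝ)) := div_pos one_pos (by linarith)
  set ε : ℝ := 1 / (3 * (n : ℝ)) with hεdef
  have h := hC ε hε W h₁ hcard
  have h3nε : (3 * n : ℕ) * ε ≤ 1 := by
    have : (3 * (n : ℝ)) * ε = 1 := by rw [hεdef]; field_simp
    push_cast
    exact this.le
  have hpow : (W.conductorNorm ℤ : ℝ) ^ ε ≤ 2 := rpow_conductor_le_two hN hε.le h3nε
  have hT' : ((2 * n - 10 : ℕ) : ℝ) ≤ multiplicativeValuationProduct W := by exact_mod_cast hT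
  have h10 : (2 * (⌈|C|⌉₊ : ℝ) + 2 : ℝ) ≤ ((2 * n - 10 : ℕ) : ℝ) := by
    have : 2 * ⌈|C|⌉₊ + 2 ≤ 2 * n - 10 := by omega
    exact_mod_cast this
  have hC1 : |C| ≤ ⌈|C|⌉₊ := Nat.le_ceil _
  have hN0 : (0 : ℝ) ≤ (W.conductorNorm ℤ : ℝ) := Nat.cast_nonneg _
  have hCle : C * (W.conductorNorm ℤ : ℝ) ^ ε ≤ |C| * 2 := by
    calc C * (W.conductorNorm ℤ : ℝ) ^ ε ≤ |C| * (W.conductorNorm ℤ : ℝ) ^ ε :=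
          mul_le_mul_of_nonneg_right (le_abs_self C) (Real.rpow_nonneg hN0 _)
      _ ≤ |C| * 2 := mul_le_mul_of_nonneg_left hpow (abs_nonneg C)
  linarith

/-- **`C(ε) ≥ 1/(8ε)`, unconditionally.** There is `ε₀ > 0` such that for `0 < ε ≤ ε₀` every
constant `C` with `T(E) ≤ C N^ε` on the few-prime class satisfies `C ≥ 1/(8ε)`: take the Chen
member with `n = ⌊1/(3ε)⌋`, so `N^ε ≤ 2` and `T ≥ 2n - 10 ≥ 2/(3ε) - 12`. (Under Szpiro the least
constant is `≤ (c/ε)^4`; the true order of `C(ε)` is open.) -/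
theorem fewPrimeBoundWith_const_ge :
    ∃ ε₀ : ℝ, 0 < ε₀ ∧ ∀ ε : ℝ, 0 < ε → ε ≤ ε₀ → ∀ C : ℝ, FewPrimeBoundWith C ε →
      1 / (8 * ε) ≤ C := by
  obtain ⟨n₀, hn₀⟩ := exists_chen_member
  refine ⟨min (1 / 30) (1 / (3 * ((n₀ : ℝ) + 1))), by positivity, fun ε hε hεle C hC => ?_⟩
  have hε30 : ε ≤ 1 / 30 := hεle.trans (min_le_left _ _)
  have hεn₀ : ε ≤ 1 / (3 * ((n₀ : ℝ) + 1)) := hεle.trans (min_le_right _ _)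
  set x : ℝ := 1 / (3 * ε) with hx
  have hx0 : 0 ≤ x := by positivity
  have hxε : x * ε = 1 / 3 := by rw [hx]; field_simp
  set n : ℕ := ⌊x⌋₊ with hn
  have hxn₀ : (n₀ : ℝ) + 1 ≤ x := by
    rw [hx, le_div_iff₀ (by positivity)]
    have := (le_div_iff₀ (by positivity : (0 : ℝ) < 3 * ((n₀ : ℝ) + 1))).mp hεn₀
    linarith
  have hn₀n : n₀ ≤ n := by
    rw [hn]; apply Nat.le_floor; linarith
  have hnx : (n : ℝ) ≤ x := Nat.floor_le hx0
  have hxn : x < n + 1 := Nat.lt_floor_add_one x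
  have hx10 : (10 : ℝ) ≤ x := by rw [hx, le_div_iff₀ (by positivity)]; linarith
  have hn10 : 10 ≤ n := by rw [hn]; exact Nat.le_floor (by exact_mod_cast hx10)
  obtain ⟨W, hE, h₁, hcard, -, -, -, hT, hN⟩ := hn₀ n hn₀n
  haveI := hE
  have h := hC W h₁ hcard
  have h3nε : (3 * n : ℕ) * ε ≤ 1 := by
    push_cast
    nlinarith [mul_le_mul_of_nonneg_right hnx hε.le]
  have hpow : (W.conductorNorm ℤ : ℝ) ^ ε ≤ 2 := rpow_conductor_le_two hN hε.le h3nε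
  have hT' : ((2 * n - 10 : ℕ) : ℝ) ≤ multiplicativeValuationProduct W := by exact_mod_cast hT
  have hcast : ((2 * n - 10 : ℕ) : ℝ) = 2 * (n : ℝ) - 10 := by
    rw [Nat.cast_sub (by omega), Nat.cast_mul]; norm_num
  rw [hcast] at hT'
  have hn10' : (10 : ℝ) ≤ n := by exact_mod_cast hn10
  have hN0 : (0 : ℝ) ≤ (W.conductorNorm ℤ : ℝ) := Nat.cast_nonneg _
  have hC0 : 0 ≤ C := by
    by_contra hneg
    push Not at hneg
    have : C * (W.conductorNorm ℤ : ℝ) ^ ε ≤ 0 :=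
      mul_nonpos_of_nonpos_of_nonneg hneg.le (Real.rpow_nonneg hN0 _)
    linarith
  have hCN : C * (W.conductorNorm ℤ : ℝ) ^ ε ≤ C * 2 := mul_le_mul_of_nonneg_left hpow hC0
  have key : (n : ℝ) - 5 ≤ C := by linarith
  have h524 : (6 : ℝ) ≤ 5 / (24 * ε) := by rw [le_div_iff₀ (by positivity)]; linarith
  have hid : 1 / (8 * ε) = x - 5 / (24 * ε) := by rw [hx]; field_simp; ring
  linarith

/-! ### (b) Tightness: the few-prime truth is at least linear in `log N` -/

/-- **Tightness.** For every `C` the few-prime class contains a curve with `T ≥ C` and at the same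
time `T ≥ (log N)/3`: along the Chen family `T ≥ 2n - 10` while `log N < 3n log 2`. (With the finer
`N < 2^{2n+1}` one gets `T ≥ (1/log 2 - o(1)) log N`; under Szpiro `T ≤ (A + 10 log N)^4`.) -/
theorem fewPrime_unbounded_and_log_le (C : ℝ) :
    ∃ (W : WeierstrassCurve ℚ), W.IsElliptic ∧
      (∀ p : ℕ, p.Prime → p ≠ 2 → ¬ p ^ 2 ∣ W.conductorNorm ℤ) ∧
      ((W.conductorNorm ℤ).primeFactors.filter
          (fun p => p ≠ 2 ∧ ¬ p ^ 2 ∣ W.conductorNorm ℤ)).card ≤ 3 ∧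
      C ≤ multiplicativeValuationProduct W ∧
      Real.log (W.conductorNorm ℤ) / 3 ≤ multiplicativeValuationProduct W := by
  obtain ⟨n₀, hn₀⟩ := exists_chen_member
  set n : ℕ := n₀ + ⌈C⌉₊ + 10 with hn
  obtain ⟨W, hE, h₁, hcard, -, h4, -, hT, hN⟩ := hn₀ n (by omega)
  have hT' : ((2 * n - 10 : ℕ) : ℝ) ≤ multiplicativeValuationProduct W := by exact_mod_cast hT
  refine ⟨W, hE, h₁, hcard, ?_, ?_⟩
  · have h1 : C ≤ ⌈C⌉₊ := Nat.le_ceil _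
    have h2 : (⌈C⌉₊ : ℝ) ≤ ((2 * n - 10 : ℕ) : ℝ) := by
      exact_mod_cast (by omega : ⌈C⌉₊ ≤ 2 * n - 10)
    linarith
  · have hN0 : W.conductorNorm ℤ ≠ 0 := fun h0 => h4 (h0 ▸ dvd_zero _)
    have hNpos : (0 : ℝ) < W.conductorNorm ℤ := by exact_mod_cast Nat.pos_of_ne_zero hN0
    have hNle : (W.conductorNorm ℤ : ℝ) ≤ (2 : ℝ) ^ (3 * n : ℕ) := by exact_mod_cast hN.le
    have hlog : Real.log (W.conductorNorm ℤ) ≤ (3 * n : ℕ) * Real.log 2 := by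
      calc Real.log (W.conductorNorm ℤ) ≤ Real.log ((2 : ℝ) ^ (3 * n : ℕ)) :=
            Real.log_le_log hNpos hNle
        _ = (3 * n : ℕ) * Real.log 2 := Real.log_pow _ _
    have hlog2 : Real.log 2 ≤ 1 := by
      have := Real.log_le_sub_one_of_pos (zero_lt_two : (0 : ℝ) < 2); linarith
    have hcast : ((2 * n - 10 : ℕ) : ℝ) = 2 * (n : ℝ) - 10 := by
      rw [Nat.cast_sub (by omega), Nat.cast_mul]; norm_num
    have hn10 : (10 : ℝ) ≤ n := by exact_mod_cast (by omega : 10 ≤ n)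
    rw [hcast] at hT'
    push_cast at hlog
    have hnl : (n : ℝ) * Real.log 2 ≤ (n : ℝ) * 1 :=
      mul_le_mul_of_nonneg_left hlog2 (Nat.cast_nonneg n)
    rw [div_le_iff₀ (by norm_num : (0 : ℝ) < 3)]
    linarith

/-! ### (c) No valuation bound depending on the prime alone -/

/-- **No Mestre–Oesterlé-type bound in the prime alone.** There is no function `f` with
`v_p(Δ_min(E)) ≤ f(p)` for every `E` in the few-prime class and every multiplicative prime `p ∥ N_E`:
the Chen family has `2 ∥ N` and `v₂(Δ_min) ≥ 2n - 10`. (Mestre–Oesterlé's `v_p(Δ_min) ≤ 5` for PRIME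
conductor `N = p` does not extend to any bound uniform in the curve; cf. also
`Literature.NumberTheory.EllipticCurves.not_fewPrimeValuationProduct_le_five`.) -/
theorem not_fewPrime_valuation_le_of_prime :
    ¬ ∃ f : ℕ → ℝ, ∀ (W : WeierstrassCurve ℚ) [W.IsElliptic],
      (∀ p : ℕ, p.Prime → p ≠ 2 → ¬ p ^ 2 ∣ W.conductorNorm ℤ) →
      ((W.conductorNorm ℤ).primeFactors.filter
          (fun p => p ≠ 2 ∧ ¬ p ^ 2 ∣ W.conductorNorm ℤ)).card ≤ 3 →
      ∀ p ∈ (W.conductorNorm ℤ).primeFactors, ¬ p ^ 2 ∣ W.conductorNorm ℤ →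
        (((W.minimalDiscriminantNorm ℤ).factorization p : ℕ) : ℝ) ≤ f p := by
  rintro ⟨f, hf⟩
  obtain ⟨n₀, hn₀⟩ := exists_chen_member
  set n : ℕ := n₀ + ⌈f 2⌉₊ + 6 with hn
  obtain ⟨W, hE, h₁, hcard, h2, h4, hv, -, -⟩ := hn₀ n (by omega)
  haveI := hE
  have hN0 : W.conductorNorm ℤ ≠ 0 := fun h0 => h4 (h0 ▸ dvd_zero _)
  have hmem : 2 ∈ (W.conductorNorm ℤ).primeFactors :=
    Nat.mem_primeFactors.mpr ⟨Nat.prime_two, h2, hN0⟩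
  have h := hf W h₁ hcard 2 hmem h4
  have hv' : ((2 * n - 10 : ℕ) : ℝ) ≤ (((W.minimalDiscriminantNorm ℤ).factorization 2 : ℕ) : ℝ) := by
    exact_mod_cast hv
  have hf1 : f 2 ≤ ⌈f 2⌉₊ := Nat.le_ceil _
  have hf2 : (⌈f 2⌉₊ : ℝ) < ((2 * n - 10 : ℕ) : ℝ) := by
    exact_mod_cast (by omega : ⌈f 2⌉₊ < 2 * n - 10)
  linarith


/-! ### The statements under attack (bodies of the sketch's `def`s with parameters exposed) -/

/-- The body of `Sketch.PowerOfTwoFacePolylog` (crux-idea `matveev-face-clearing`) with the exponent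
`A` and the constant `κ` as parameters: on abc triples supported on `≤ 4` primes with a member equal
to a power of two, every exponent is `≤ κ (log rad)^A`. The card's statement is
`∃ A κ, FacePolylogWith A κ`. -/
def FacePolylogWith (A κ : ℝ) : Prop :=
  ∀ a b c : ℕ, IsABCTriple a b c → (a * b * c).primeFactors.card ≤ 4 →
    ((∃ j : ℕ, a = 2 ^ j) ∨ (∃ j : ℕ, b = 2 ^ j) ∨ (∃ j : ℕ, c = 2 ^ j)) →
    ∀ p ∈ (a * b * c).primeFactors,
      ((a * b * c).factorization p : ℝ) ≤ κ * (Real.log ((rad a b c : ℕ) : ℝ)) ^ A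

/-- The body of `Sketch.FreyFewPrimeValuationProduct` with `ε` DROPPED: a uniform bound on the
valuation product of abc triples with `≤ 4` prime factors. -/
def FreyFewPrimeWithoutEps : Prop :=
  ∃ C : ℝ, ∀ a b c : ℕ, IsABCTriple a b c → (a * b * c).primeFactors.card ≤ 4 →
    ((∏ p ∈ (a * b * c).primeFactors, (a * b * c).factorization p : ℕ) : ℝ) ≤ C

/-! ### Chen triples on the power-of-two face -/

/-- **Chen triples.** For every large `n` there is an abc triple `a + b = 2^e` with `n ≤ e + 1`,
supported on at most `4` primes, with `v₂(abc) = e` and `3 ≤ rad(abc) < 2^{3e}`. From Chen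
(`chen_goldbach_holds`): `2ⁿ = ℓ + m`, `ℓ` prime, `Ω(m) ≤ 2`; if `ℓ` is odd take `(ℓ, m, 2ⁿ)`; if
`ℓ = 2` then `m = 2(2ⁿ⁻¹ - 1)` forces `2ⁿ⁻¹ - 1` prime and we take `(1, 2ⁿ⁻¹ - 1, 2ⁿ⁻¹)`. -/
theorem exists_chen_triple : ∃ n₀ : ℕ, ∀ n : ℕ, n₀ ≤ n → ∃ a b e : ℕ,
    IsABCTriple a b (2 ^ e) ∧ (a * b * 2 ^ e).primeFactors.card ≤ 4 ∧ n ≤ e + 1 ∧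
    (a * b * 2 ^ e).factorization 2 = e ∧ rad a b (2 ^ e) < 2 ^ (3 * e) ∧ 3 ≤ rad a b (2 ^ e) := by
  obtain ⟨N₀, hN₀⟩ := Literature.NumberTheory.Sieve.chen_goldbach_holds
  refine ⟨N₀ + 3, fun n hn => ?_⟩
  have hnN : N₀ ≤ 2 ^ n := le_trans (by omega) (Nat.lt_two_pow_self).le
  have heven : Even (2 ^ n) := (Nat.even_pow' (by omega)).mpr even_two
  obtain ⟨ℓ, m, hℓ, ⟨hm0, hΩ⟩, hsum⟩ := hN₀ (2 ^ n) hnN heven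
  have hωm : m.primeFactors.card ≤ 2 := (card_primeFactors_le_cardFactors m).trans hΩ
  have h2n : (2 : ℕ) ∣ 2 ^ n := dvd_pow_self 2 (by omega)
  by_cases hℓ2 : ℓ = 2
  · -- `m = 2 (2ⁿ⁻¹ - 1)` with `2ⁿ⁻¹ - 1` prime: the triple `1 + (2ⁿ⁻¹ - 1) = 2ⁿ⁻¹`
    subst hℓ2
    have hpow : 2 ^ n = 2 * 2 ^ (n - 1) := by
      rw [← pow_succ', Nat.sub_add_cancel (by omega : 1 ≤ n)]
    have h4 : 2 ^ 2 ≤ 2 ^ (n - 1) := Nat.pow_le_pow_right two_pos (by omega)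
    set c := 2 ^ (n - 1) with hc
    set b := c - 1 with hb
    have hmb : m = 2 * b := by omega
    have hb3 : 3 ≤ b := by omega
    have hb0 : b ≠ 0 := by omega
    have h2c : (2 : ℕ) ∣ c := by rw [hc]; exact dvd_pow_self 2 (by omega)
    have hbodd : ¬ 2 ∣ b := by omega
    have hbprime : b.Prime := by
      have hΩm : Ω m = Ω 2 + Ω b := by
        rw [hmb, ArithmeticFunction.cardFactors_mul two_ne_zero hb0]
      rw [ArithmeticFunction.cardFactors_apply_prime Nat.prime_two] at hΩm
      have hΩb : Ω b ≤ 1 := by omega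
      have hΩb0 : Ω b ≠ 0 := by
        intro h0
        rcases ArithmeticFunction.cardFactors_eq_zero_iff_eq_zero_or_one.mp h0 with h | h <;> omega
      exact ArithmeticFunction.cardFactors_eq_one_iff_prime.mp (by omega)
    have habc0 : 1 * b * c ≠ 0 := by positivity
    have hbc : b ∈ (1 * b * c).primeFactors :=
      Nat.mem_primeFactors.mpr ⟨hbprime, ⟨c, by ring⟩, habc0⟩
    refine ⟨1, b, n - 1, ⟨one_pos, by omega, by omega, Nat.coprime_one_left b⟩, ?_, by omega,
      ?_, ?_, ?_⟩
    · rw [one_mul, Nat.primeFactors_mul hb0 (by positivity), hbprime.primeFactors, ← hc,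
        show c = 2 ^ (n - 1) from hc, Nat.primeFactors_pow _ (by omega), Nat.prime_two.primeFactors]
      exact (Finset.card_union_le _ _).trans (by simp)
    · rw [one_mul, Nat.factorization_mul hb0 (by positivity)]
      simp [Nat.factorization_eq_zero_of_not_dvd hbodd, Nat.prime_two.factorization_self]
    · -- `rad ≤ b c < c · c ≤ 2^{3(n-1)}`
      rw [← hc]
      have hle : rad 1 b c ≤ 1 * b * c := Nat.radical_le_self_iff.mpr habc0
      have hlt : 1 * b * c < c * c := by
        rw [one_mul]; exact Nat.mul_lt_mul_of_pos_right (by omega) (by omega)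
      have hcc : c * c ≤ 2 ^ (3 * (n - 1)) := by
        rw [hc, ← pow_add]; exact Nat.pow_le_pow_right two_pos (by omega)
      omega
    · -- `b ∣ rad`, `b ≥ 3`
      rw [← hc]
      have hmem : b ∈ (rad 1 b c).primeFactors := by
        rw [rad, Nat.primeFactors_radical]; exact hbc
      have h0 : rad 1 b c ≠ 0 := (Nat.mem_primeFactors.mp hmem).2.2
      exact hb3.trans (Nat.le_of_dvd (Nat.pos_of_ne_zero h0) (Nat.dvd_of_mem_primeFactors hmem))
  · -- `ℓ` odd, `m` odd: the triple `ℓ + m = 2ⁿ`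
    have hℓodd : ¬ 2 ∣ ℓ := fun h =>
      hℓ2 ((Nat.prime_dvd_prime_iff_eq Nat.prime_two hℓ).mp h).symm
    have hmodd : ¬ 2 ∣ m := by omega
    have hℓ3 : 3 ≤ ℓ := by have := hℓ.two_le; omega
    have hcop : Nat.Coprime ℓ m := by
      rw [Nat.Prime.coprime_iff_not_dvd hℓ]
      intro h
      have : ℓ ∣ 2 ^ n := by rw [← hsum]; exact dvd_add dvd_rfl h
      exact hℓ2 ((Nat.prime_dvd_prime_iff_eq hℓ Nat.prime_two).mp (hℓ.dvd_of_dvd_pow this))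
    have habc0 : ℓ * m * 2 ^ n ≠ 0 := mul_ne_zero (mul_ne_zero hℓ.ne_zero hm0) (by positivity)
    have hℓlt : ℓ < 2 ^ n := by have := Nat.pos_of_ne_zero hm0; omega
    have hmlt : m < 2 ^ n := by omega
    refine ⟨ℓ, m, n, ⟨hℓ.pos, Nat.pos_of_ne_zero hm0, hsum, hcop⟩, ?_, by omega, ?_, ?_, ?_⟩
    · rw [Nat.primeFactors_mul (mul_ne_zero hℓ.ne_zero hm0) (by positivity),
        Nat.primeFactors_mul hℓ.ne_zero hm0, hℓ.primeFactors, Nat.primeFactors_pow _ (by omega),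
        Nat.prime_two.primeFactors]
      have h1 : ({ℓ} ∪ m.primeFactors).card ≤ 3 :=
        (Finset.card_union_le _ _).trans (by rw [Finset.card_singleton]; omega)
      exact (Finset.card_union_le _ _).trans (by rw [Finset.card_singleton]; omega)
    · rw [Nat.factorization_mul (mul_ne_zero hℓ.ne_zero hm0) (by positivity),
        Nat.factorization_mul hℓ.ne_zero hm0]
      simp [Nat.factorization_eq_zero_of_not_dvd hℓodd, Nat.factorization_eq_zero_of_not_dvd hmodd,
        Nat.prime_two.factorization_self]
    · have hle : rad ℓ m (2 ^ n) ≤ ℓ * m * 2 ^ n := Nat.radical_le_self_iff.mpr habc0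
      have h3n : 2 ^ n * 2 ^ n * 2 ^ n = 2 ^ (3 * n) := by
        rw [show 3 * n = n + n + n by ring, pow_add, pow_add]
      have hlt : ℓ * m * 2 ^ n < 2 ^ n * 2 ^ n * 2 ^ n := by
        have h1 : ℓ * m < 2 ^ n * 2 ^ n :=
          calc ℓ * m ≤ ℓ * 2 ^ n := Nat.mul_le_mul_left _ hmlt.le
            _ < 2 ^ n * 2 ^ n := Nat.mul_lt_mul_of_pos_right hℓlt (by positivity)
        exact Nat.mul_lt_mul_of_pos_right h1 (by positivity)
      omega
    · have hmem : ℓ ∈ (rad ℓ m (2 ^ n)).primeFactors := by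
        rw [rad, Nat.primeFactors_radical]
        exact Nat.mem_primeFactors.mpr ⟨hℓ, ⟨m * 2 ^ n, by ring⟩, habc0⟩
      have h0 : rad ℓ m (2 ^ n) ≠ 0 := (Nat.mem_primeFactors.mp hmem).2.2
      exact hℓ3.trans (Nat.le_of_dvd (Nat.pos_of_ne_zero h0) (Nat.dvd_of_mem_primeFactors hmem))

/-! ### The face dividend needs `A ≥ 1` -/

/-- **`PowerOfTwoFacePolylog` is false for every exponent `A < 1`.** On the Chen triples
`a + b = 2^e` the exponent at `2` is `e` while `log rad < 3e log 2 ≤ 3e`, so `e ≤ κ (log rad)^A`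
fails for large `e` whenever `A < 1` (for `A ≤ 0` already because `log rad ≥ 1`). -/
theorem not_facePolylogWith_of_lt_one {A : ℝ} (hA : A < 1) (κ : ℝ) : ¬ FacePolylogWith A κ := by
  intro h
  obtain ⟨n₀, hn₀⟩ := exists_chen_triple
  set A' : ℝ := max A 0 with hA'
  have hA'0 : 0 ≤ A' := le_max_right _ _
  have hA'1 : A' < 1 := max_lt hA one_pos
  have h1A : 0 < 1 - A' := by linarith
  have hK0 : (0 : ℝ) ≤ max (3 * κ) 1 := le_trans zero_le_one (le_max_right _ _)
  set X : ℝ := (max (3 * κ) 1) ^ (1 / (1 - A')) with hX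
  have hX0 : 0 ≤ X := Real.rpow_nonneg hK0 _
  set n : ℕ := ⌈X⌉₊ + n₀ + 2 with hn
  obtain ⟨a, b, e, habc, hcard, hne, hfac, hradlt, hrad3⟩ := hn₀ n (by omega)
  have he1 : 1 ≤ e := by omega
  have hface : (∃ j : ℕ, a = 2 ^ j) ∨ (∃ j : ℕ, b = 2 ^ j) ∨ (∃ j : ℕ, (2 ^ e : ℕ) = 2 ^ j) :=
    Or.inr (Or.inr ⟨e, rfl⟩)
  have h0 : a * b * 2 ^ e ≠ 0 :=
    mul_ne_zero (mul_ne_zero habc.1.ne' habc.2.1.ne') (by positivity)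
  have h2mem : 2 ∈ (a * b * 2 ^ e).primeFactors :=
    Nat.mem_primeFactors.mpr ⟨Nat.prime_two, dvd_mul_of_dvd_right (dvd_pow_self 2 (by omega)) _, h0⟩
  have hb := h a b (2 ^ e) habc hcard hface 2 h2mem
  rw [hfac] at hb
  -- bounds on `L = log rad`
  set L : ℝ := Real.log ((rad a b (2 ^ e) : ℕ) : ℝ) with hL
  have hrad3' : (3 : ℝ) ≤ (rad a b (2 ^ e) : ℕ) := by exact_mod_cast hrad3
  have hexp1 : Real.exp 1 ≤ 3 := le_trans Real.exp_one_lt_d9.le (by norm_num)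
  have hL1 : 1 ≤ L := by
    rw [hL, ← Real.log_exp 1]
    exact Real.log_le_log (Real.exp_pos 1) (hexp1.trans hrad3')
  have hlog2 : Real.log 2 ≤ 1 := by
    have := Real.log_le_sub_one_of_pos (zero_lt_two : (0 : ℝ) < 2); linarith
  have hLle : L ≤ 3 * e := by
    have : ((rad a b (2 ^ e) : ℕ) : ℝ) ≤ (2 : ℝ) ^ (3 * e : ℕ) := by exact_mod_cast hradlt.le
    calc L ≤ Real.log ((2 : ℝ) ^ (3 * e : ℕ)) := Real.log_le_log (by positivity) this
      _ = (3 * e : ℕ) * Real.log 2 := Real.log_pow _ _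
      _ ≤ (3 * e : ℕ) * 1 := mul_le_mul_of_nonneg_left hlog2 (Nat.cast_nonneg _)
      _ = 3 * e := by push_cast; ring
  have he0 : (0 : ℝ) < e := by exact_mod_cast he1
  rcases le_or_gt κ 0 with hκ | hκ
  · -- `κ ≤ 0`: the bound is `≤ 0 < e`
    have : κ * L ^ A ≤ 0 := mul_nonpos_of_nonpos_of_nonneg hκ (Real.rpow_nonneg (by linarith) _)
    linarith
  · -- `κ > 0`: `e ≤ κ L^A ≤ κ L^{A'} ≤ κ 3^{A'} e^{A'} ≤ 3κ e^{A'} < e^{1-A'} e^{A'} = e`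
    have hLA : L ^ A ≤ L ^ A' := Real.rpow_le_rpow_of_exponent_le hL1 (le_max_left _ _)
    have hLA' : L ^ A' ≤ (3 * (e : ℝ)) ^ A' := Real.rpow_le_rpow (by linarith) hLle hA'0
    have h3e : (3 * (e : ℝ)) ^ A' = (3 : ℝ) ^ A' * (e : ℝ) ^ A' :=
      Real.mul_rpow (by norm_num) he0.le
    have h3A : (3 : ℝ) ^ A' ≤ 3 := by
      calc (3 : ℝ) ^ A' ≤ (3 : ℝ) ^ (1 : ℝ) :=
            Real.rpow_le_rpow_of_exponent_le (by norm_num) hA'1.le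
        _ = 3 := Real.rpow_one 3
    have hXe : X < e := by
      have h1 : X ≤ ⌈X⌉₊ := Nat.le_ceil X
      have h2 : ((⌈X⌉₊ + 1 : ℕ) : ℝ) ≤ e := by exact_mod_cast (by omega : ⌈X⌉₊ + 1 ≤ e)
      push_cast at h2
      linarith
    have hXpow : X ^ (1 - A') = max (3 * κ) 1 := by
      rw [hX, ← Real.rpow_mul hK0, one_div, inv_mul_cancel₀ h1A.ne', Real.rpow_one]
    have hepow : max (3 * κ) 1 < (e : ℝ) ^ (1 - A') := by
      rw [← hXpow]; exact Real.rpow_lt_rpow hX0 hXe h1A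
    have hesplit : (e : ℝ) ^ (1 - A') * (e : ℝ) ^ A' = e := by
      rw [← Real.rpow_add he0]; simp
    have heA'pos : 0 < (e : ℝ) ^ A' := Real.rpow_pos_of_pos he0 _
    have : κ * L ^ A < e := by
      calc κ * L ^ A ≤ κ * L ^ A' := mul_le_mul_of_nonneg_left hLA hκ.le
        _ ≤ κ * ((3 : ℝ) ^ A' * (e : ℝ) ^ A') := by
            rw [← h3e]; exact mul_le_mul_of_nonneg_left hLA' hκ.le
        _ ≤ κ * (3 * (e : ℝ) ^ A') :=
            mul_le_mul_of_nonneg_left (mul_le_mul_of_nonneg_right h3A heA'pos.le) hκ.le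
        _ = (3 * κ) * (e : ℝ) ^ A' := by ring
        _ ≤ max (3 * κ) 1 * (e : ℝ) ^ A' := mul_le_mul_of_nonneg_right (le_max_left _ _) heA'pos.le
        _ < (e : ℝ) ^ (1 - A') * (e : ℝ) ^ A' := mul_lt_mul_of_pos_right hepow heA'pos
        _ = e := hesplit
    linarith

/-- Equivalently: any exponent `A` for which the face dividend holds (with some constant) is `≥ 1`. -/
theorem one_le_of_facePolylogWith {A κ : ℝ} (h : FacePolylogWith A κ) : 1 ≤ A := by
  by_contra hA
  exact not_facePolylogWith_of_lt_one (lt_of_not_ge hA) κ h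

/-! ### The Frey form of the crux needs its `ε` -/

/-- **The `ε` of `FreyFewPrimeValuationProduct` cannot be dropped**: there is no uniform bound on
`∏_{p ∣ abc} v_p(abc)` over abc triples with at most `4` prime factors (Chen triples: the factor at
`2` alone is `e → ∞`, all other factors are `≥ 1`). -/
theorem freyFewPrime_false_without_eps : ¬ FreyFewPrimeWithoutEps := by
  rintro ⟨C, hC⟩
  obtain ⟨n₀, hn₀⟩ := exists_chen_triple
  set n : ℕ := ⌈C⌉₊ + n₀ + 2 with hn
  obtain ⟨a, b, e, habc, hcard, hne, hfac, -, -⟩ := hn₀ n (by omega)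
  have h := hC a b (2 ^ e) habc hcard
  have he : 1 ≤ e := by omega
  have h0 : a * b * 2 ^ e ≠ 0 :=
    mul_ne_zero (mul_ne_zero habc.1.ne' habc.2.1.ne') (by positivity)
  have h2mem : 2 ∈ (a * b * 2 ^ e).primeFactors :=
    Nat.mem_primeFactors.mpr ⟨Nat.prime_two, dvd_mul_of_dvd_right (dvd_pow_self 2 (by omega)) _, h0⟩
  have hprod : e ≤ ∏ p ∈ (a * b * 2 ^ e).primeFactors, (a * b * 2 ^ e).factorization p := by
    rw [← Finset.mul_prod_erase _ _ h2mem, hfac]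
    refine Nat.le_mul_of_pos_right _ (Finset.prod_pos fun p hp => ?_)
    have hp := (Finset.mem_erase.mp hp).2
    exact (Nat.prime_of_mem_primeFactors hp).factorization_pos_of_dvd h0
      (Nat.dvd_of_mem_primeFactors hp)
  have h1 : C ≤ ⌈C⌉₊ := Nat.le_ceil C
  have h2 : ((⌈C⌉₊ + 1 : ℕ) : ℝ) ≤ e := by exact_mod_cast (by omega : ⌈C⌉₊ + 1 ≤ e)
  have h3 : (e : ℝ) ≤ ((∏ p ∈ (a * b * 2 ^ e).primeFactors, (a * b * 2 ^ e).factorization p : ℕ) : ℝ) := by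
    exact_mod_cast hprod
  push_cast at h2
  linarith


/-! ### (e) The hard-core `ε`-drop, modulo a prime pattern -/

/-- The body of `Sketch.HardCoreBound` (crux-idea `matveev-face-clearing`) with `C, ε` as
parameters: the crux restricted to hard-core Frey triples `±p^x ± q^y = 2^k r^z` (one odd prime per
member), in exponent form `xyz ≤ C (2pqr)^ε`. -/
def HardCoreBoundWith (C ε : ℝ) : Prop :=
  ∀ p q r x y z k : ℕ, p.Prime → q.Prime → r.Prime →
    Odd p → Odd q → Odd r → p ≠ q → p ≠ r → q ≠ r → 0 < x → 0 < y → 0 < z → 0 < k →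
    (p ^ x + q ^ y = 2 ^ k * r ^ z ∨ p ^ x + 2 ^ k * r ^ z = q ^ y ∨ q ^ y + 2 ^ k * r ^ z = p ^ x) →
      ((x * y * z : ℕ) : ℝ) ≤ C * ((2 * p * q * r : ℕ) : ℝ) ^ ε

/-- PRIME PATTERN (open; of Sophie Germain / Lemoine type — one linear equation in two prime
unknowns — predicted with positive density by the Hardy–Littlewood heuristics, out of reach of
Chen-type sieves, which control only ONE of the two summands): for unboundedly many `x` there are odd
primes `q ≠ r`, both `≠ 3`, with `3^x + 2r = q`. -/
def ThreePowPlusTwicePrimePattern : Prop :=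
  ∀ M : ℕ, ∃ x, M ≤ x ∧ ∃ q r : ℕ, q.Prime ∧ r.Prime ∧ Odd q ∧ Odd r ∧ q ≠ 3 ∧ r ≠ 3 ∧ q ≠ r ∧
    3 ^ x + 2 * r = q

/-- **The `ε`-drop of `HardCoreBound` is false MODULO the prime pattern**: each instance
`3^x + 2·r = q` is a hard-core triple (`p = 3`, `k = y = z = 1`) with `xyz = x`, unbounded. NOT
unconditional — it records the exact arithmetic input a refutation of the hard-core `ε`-drop needs;
every unconditional family of this file lies on the power-of-two face instead (Chen controls the
prime factors of one summand only). Any HC family with `xyz → ∞` is a binary prime pattern of this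
kind (two of `p^x, q^y, 2^k r^z` must be prime powers of prescribed shape). -/
theorem not_hardCoreBoundWith_zero_of_pattern (H : ThreePowPlusTwicePrimePattern) (C : ℝ) :
    ¬ HardCoreBoundWith C 0 := by
  intro h
  obtain ⟨x, hx, q, r, hq, hr, hqodd, hrodd, hq3, hr3, hqr, heq⟩ := H (⌈C⌉₊ + 1)
  have h3odd : Odd 3 := by decide
  have hx0 : 0 < x := by omega
  have key := h 3 q r x 1 1 1 Nat.prime_three hq hr h3odd hqodd hrodd (Ne.symm hq3) (Ne.symm hr3)
    hqr hx0 one_pos one_pos one_pos (Or.inr (Or.inl (by simpa using heq)))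
  simp only [mul_one, Real.rpow_zero] at key
  have h1 : C ≤ ⌈C⌉₊ := Nat.le_ceil C
  have h2 : ((⌈C⌉₊ + 1 : ℕ) : ℝ) ≤ x := by exact_mod_cast hx
  push_cast at h2
  linarith


end CycleTwo

end Summit.ABC.ABC.Cruxes.FewPrimeValuationProduct.Disproof
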